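import Mathlib
import Summits.AnomalousDissipation.AnomalousDissipation.Theses.TwoAndHalfD
import Summits.AnomalousDissipation.AnomalousDissipation.Theorems.TwodBoundedEnergyZeroMomentum.Negative.FirstShellGeneral
import Summits.AnomalousDissipation.AnomalousDissipation.Theorems.TwodBoundedEnergyZeroMomentum.Negative.SteadyShellIdentity
import Summits.AnomalousDissipation.AnomalousDissipation.Theorems.TwodBoundedEnergyZeroMomentum.Negative.SteadyScaling
import Summits.AnomalousDissipation.AnomalousDissipation.Theorems.TwodBoundedEnergyZeroMomentum.Negative.SteadyBounds
import Summits.AnomalousDissipation.AnomalousDissipation.Theorems.TwodBoundedEnergyZeroMomentum.Negative.EnergyFloorSym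
import Literature.Barriers.AnomalousDissipation.GravestModeLaminarAttractorProofs
import Literature.Barriers.AnomalousDissipation.GravestModeLaminarAttractorSwept
import Literature.Analysis.FluidPDE.LerayHopfSpectralMeasurability
import Literature.Analysis.FluidPDE.DoeringFoiasPowerProofs
import Literature.Analysis.FluidPDE.LerayHopfTimeSliceTorus
import Literature.Analysis.FluidPDE.LerayHopfUniformEnergy
import Literature.Analysis.FluidPDE.CheskidovAssemblyTools
import Literature.Analysis.FluidPDE.LongTimeAverageNonneg

/-!
# Disproof work file for the crux `TwodBoundedEnergyZeroMomentum` (stmt-AnomalousDissipation-10786)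

Standing adversary file (cdisprove seats `refuter-cdisprove-stmt-AnomalousDissipation-10786-0` (gen 1, §0–§E)
and `refuter-cdisprove-stmt-AnomalousDissipation-10786-g2-0` (gen 2, §F onwards)).
The crux is an EXISTENTIAL over the printed open problem "existence of bounded sequences of
stationary solutions of the periodic, forced Navier–Stokes equations, and even of solutions with
bounded average dissipation of energy" (Constantin–Tarfulea–Vicol 2013, arXiv:1305.7089, p. 3),
in its bounded-MEAN-ENERGY, ZERO-MOMENTUM form; a Lean disproof would be a universal theorem on
steadily forced 2-D Navier–Stokes at vanishing viscosity.  VERDICT SO FAR: resists (no kill); the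
only rigorous obstruction is first-shell rigidity (§B), and DNS (Gallet–Young 2013, reported by
CTV2013 p. 3: a condensate "with bounded amplitude as viscosity vanishes") points to TRUE for
forces above the first shell.  Findings, all `sorry`-free:

* §0 tools (reusable by provers): `tendsto_timeMean_of_tendsto` / `longTimeAvgSup_eq_of_tendsto`
  (Cesàro: a convergent locally integrable observable has long-time average = its limit);
  `tendsto_integral_norm_sq_of_tendsto_eLpNorm` (`L²` convergence ⇒ convergence of energies).
* §B TIGHTNESS / RIGIDITY AT THE FIRST SHELL: `meanEnergy_eq_of_firstMode` — under
  `g = marchioroForce α` EVERY zero-momentum Leray–Hopf solution has `⟨‖u‖²⟩ = α²/(16π⁴ν²)`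
  exactly (Marchioro 1986 via `Marchioro1986_globalAttraction_holds`); `not_crux_firstMode` — the
  crux restricted to first-shell forces is FALSE.  Any witness `g` needs a mode OFF the first shell.
* §C `not_crux_forall_force`: the `∀ g` strengthening is false (so the choice of `g` is essential).
* §A LOAD-BEARING CONSTRAINTS (existential reading: which clause keeps cheap witnesses out):
  `cruxWithoutZeroMomentum_holds` (drop `HasZeroMean (v₀ j)`: TRUE by Galilean sweeping — the
  retired stmt-0209), `cruxWithoutVanishingViscosity_holds` (drop `ν_j → 0`: TRUE by the laminar
  spin-up from rest at `ν = 1`), `cruxWithoutNonzeroForce_holds` (drop `g ≠ 0`: rest state).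
  A proof must use all three at once: a non-laminar zero-momentum object along `ν_j → 0`.
  (Unformalised, same reading: dropping `IsDivFree g` admits the REST STATE under a pure
  gradient force `g = ∇φ ≠ 0`, absorbed by the pressure — `∫⟪∇φ, ψ⟫ = 0` for divergence-free
  tests; dropping `HasZeroMean g` admits the uniformly ACCELERATING flow `v = t·ḡ` under a
  constant force, whose Cesàro energies diverge so that `meanEnergy` takes the junk value `0`;
  `IsSmooth g` is not load-bearing for the crux (only for the route's scalar problem).)
* §D JUNK AUDIT: `hasZeroMean_slice` (momentum stays zero: constant test fields are admissible in
  `Torus.IsWeakNSSolutionForcedOn`, so the 0209 Galilean evasion is really closed) and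
  `meanEnergy_le_apriori` (`⟨‖u‖²⟩ ≤ ½‖u₀‖²/(2π²ν) + ‖g‖²/(16π⁴ν²)`: the `limsup` is honest, never
  the junk value `0`; the content of the crux is exactly uniformity in `j`).
* §E TIGHTNESS OF THE CEILING (`energy_floor`, `witness_ceiling_ge_floor`): testing the weak
  formulation with `g` itself gives, for EVERY zero-momentum Leray–Hopf solution,
  `‖g‖₂² ≤ D⟨‖u‖²⟩ + (νK/2)(1 + ⟨‖u‖²⟩)` (`∑‖∂ᵢg‖ ≤ D`, `‖Δg‖ ≤ K`), hence for every witness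
  family of the crux `‖g‖₂² ≤ D·E`: the constant `E` can never be below `‖g‖₂²/‖∇g‖_∞`, and the
  flow cannot decorrelate from `g` by being small.  This is ALL the balance laws give (an `O(1)`
  floor, no `ν⁻¹` growth) — formal content of "balance laws cannot kill it" below.
* §F (gen 2) THE WHOLE FIRST STOKES EIGENSPACE IS RIGID — not only the single pair
  `marchioroForce α`: for EVERY smooth divergence-free mean-zero `g` with Fourier support on the
  shell `|k|² = 1` (the 4-dimensional first eigenspace, crossed cellular forces
  `sin 2πx₁ e₀ ± sin 2πx₀ e₁` included) and EVERY zero-momentum global Leray–Hopf solution,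
  `⟨‖u‖²⟩ ≥ ‖g‖₂²/(16π⁴ν²)` (`meanEnergy_ge_of_firstShell`); hence `not_crux_firstShell` (the crux
  with the single extra conjunct "ĝ(k) = 0 for |k|² ≠ 1" is FALSE), `witness_has_mode_two_le`
  (EVERY witness force of the crux has `ĝ(k) ≠ 0` for some `|k|² ≥ 2` — the formal design
  constraint "g must sit above the first shell"), and the steady-state forms
  `steady_energy_ge_of_firstShell` / `not_boundedSteadyBranch_firstShell` (no bounded steady
  branch — the object of all five round-1 idea cards — exists under a first-shell force).  The
  proof avoids Marchioro's convergence-to-the-laminar-state half: (A.32)–(A.34) at the Galerkin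
  level for a general first-shell force + 2-D uniqueness give `Q₁u(t) → 0` in `L²`; testing the
  weak formulation with `g` (`Δg = -4π²g`) and killing the trilinear term by first-shell parity
  (`|l|² = |m|² = 1 ⇒ |l+m|² ≠ 1`) makes the Cesàro means of `⟨u,g⟩` tend to `‖g‖₂²/(4π²ν)`,
  whence the floor by Cauchy–Schwarz.  This closes the gen-1 item "Marchioro rigidity is proved in
  the tree only for `marchioroForce α` … not formalised".
* §G (gen 2) STEADY WITNESSES — EXACT BALANCE LAWS (landed file `Negative/SteadyShellIdentity.lean`,
  p76689; thin index in §G below): for a smooth steady state `v` of `NS_ν(g)`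
  (`Torus.IsSteadyNSState`, the object of every round-1 card): `ν‖∇v‖₂² = ∫⟪g,v⟫`
  (`steady_energy_identity`; the work is `≥ 0`), `ν∫‖Δv‖² = -∫⟪v,Δg⟫` on `𝕋²`
  (`steady_enstrophy_identity`), and for a Stokes eigenforce `Δg = -Λg` (single-shell /
  Kolmogorov forcing) the CTV 2013 §2 identity `∫‖Δv‖² = Λ‖∇v‖₂²`
  (`steady_laplacian_sq_eq_of_stokesEigenforce`), in Fourier variables
  `∑_k λ_k(λ_k - Λ)‖v̂(k)‖² = 0` (`steady_hasSum_straddle`): a steady witness under single-shell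
  forcing that carries a sub-shell condensate MUST carry modes strictly above the forcing shell
  (`steady_no_subshell_mode_of_no_supershell_mode`) — the "exact steady straddle identity" the
  cards parity-protected-swept-condensate / bilinear-euler-orbit-selection invoke, now citable.
* §H (gen 2) STEADY WITNESSES — CONE AND BOUNDS (landed files `Negative/SteadyScaling.lean` p77269,
  `Negative/SteadyBounds.lean` p77406; import them directly): `steady_smul` / `boundedSteadyBranch_smul`
  (`(ν,g,v,p) ↦ (aν,a²g,av,a²p)`: the bounded-steady-branch forces form a CONE — only the SHAPE of
  `g` matters, never its amplitude); `steady_work_sq_le` (`(∫⟪g,v⟫)² ≤ ν‖v‖₂³‖Δg‖₂`: injection =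
  dissipation is `O(ν^{1/2})` on bounded steady branches — every Euler endpoint does no work, no
  steady anomaly); `steady_firstShell_energy_le_supershell_palinstrophy`
  (`4π²(Λ-4π²)·Σ_{|k|²=1}‖v̂‖² ≤ Σ_{λ_k>Λ} λ_k²‖v̂‖²`: under single-shell forcing a condensate COSTS
  palinstrophy strictly above the forcing shell — the formal core of the quantitative remark in §G);
  `steady_sobolev_bounds_of_stokesEigenforce` (`‖∇v‖₂² ≤ Λ‖v‖₂²`, `∫‖Δv‖² ≤ Λ²‖v‖₂²` for EVERY
  steady state under a Stokes eigenforce, CTV §2 (stbounds): bounded steady branches under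
  single-shell forcing are `H²`-bounded uniformly in `ν` — no vanishing-width layers of any kind, and
  their limits are strong `H¹` limits = steady forced Euler states).
* §I (gen 2, cycle 2) THE SINGLE-SHELL PINCER FOR EVERY LERAY–HOPF SOLUTION (files
  `Negative/ShellPincerSpectral.lean` (p79841), `Negative/ShellPincerGalerkin.lean` (p81038), `Negative/ShellPincer.lean` (p82309) —
  all LANDED (import them directly; thin wrappers to be added here once the check-farm snapshot has the oleans);
  Tran–Shepherd 2002 §4 / CTV 2013 §2 (diffeq)–(enst), there only for smooth data or Galerkin
  trajectories — here for EVERY global Leray–Hopf solution from `L²` data, no mean or symmetry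
  condition): under a force supported on ONE shell `|k|² = m` (`m > 0`; every Kolmogorov forcing),
  `‖∇u(t)‖₂² ≤ 4π²m‖u(t)‖₂² + K e^{-8π²mν(t-1)}` for all `t ≥ 1` (`shellPincer_of_singleShell`), the
  DYNAMIC STRADDLE `Φ⁺(u(t)) ≤ Φ⁻(u(t)) + K e^{-8π²mν(t-1)}` (weighted super-shell energy ≤ weighted
  sub-shell energy: `shellPlus_le_shellMinus_of_singleShell` — a condensate is necessary at every late
  time, not only for steady states, §H''), `⟨‖∇u‖₂²⟩ ≤ 4π²m⟨‖u‖₂²⟩` and `ε ≤ 4π²mν⟨‖u‖₂²⟩`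
  (`longTimeAvgSup_enstrophy_le_of_singleShell`, `meanDissipation_le_of_singleShell`).  CRUX FORM
  (`witness_meanDissipation_le_of_singleShell`, `…_tendsto_zero_…`): a witness family of the crux
  driven by a single-shell `g` has `ε_j ≤ 4π²mEν_j → 0` and `ν`-UNIFORM mean enstrophy `≤ 4π²mE` —
  it is quasi-laminar in `H¹`; NOT a kill (the Gallet–Young condensate has bounded enstrophy), but
  (i) the Lean half of the route's design rule "the planar force must span ≥ 2 shells" (with the
  scalar DiPerna–Lions half on paper, barrier file `…TimePincer`), and (ii) a sharp portrait: any
  single-shell witness keeps, at every `t ≥ 1`, at least as much weighted energy below the forcing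
  shell as above it.  Proof device worth reusing: at a FIXED time the signed excess `ξ = Φ⁺ - Φ⁻`
  passes to coefficientwise limits because `Φ⁺` is lower semicontinuous (Fatou) and `Φ⁻` is a
  finite sum — no strong convergence or time integration needed.
* §H'' (gen 2) A CONDENSATE IS NECESSARY (landed file `Negative/SteadyCondensateNecessary.lean`, p77981; import it
  directly — not re-indexed below while the check-farm snapshot lacks it):
  `steady_laminar_of_no_subshell_mode` — under a single-shell force (`|k|² = r ≥ 1`, Kolmogorov
  forcing) a smooth zero-mean steady state with NO mode strictly below the forcing shell IS the laminar
  state `g/(4π²rν)` (straddle identity has only non-negative terms ⇒ `v` on the shell; there the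
  trilinear form vanishes, lattice lemma; test with `g - 4π²rν v`); hence
  `not_boundedSteadyBranch_singleShell_noSubshell`: every bounded steady witness under Kolmogorov forcing
  MUST condense below the forcing shell (and, by §G, excite modes above it), in particular must BREAK
  every symmetry excluding the sub-shell modes (e.g. `1/m`-periodicity in both coordinates under
  `sin(2πm x₁)e₀`) — symmetric-class steady states are laminar with energy `‖g‖₂²/(4π²rν)²`.
* §H' (gen 2) SHARPER ENERGY FLOOR (landed file `Negative/EnergyFloorSym.lean`, p77468; Lean target asked for by
  crux-ideate gen 2, `NegativeNotesIdeator1g2.md` §BN1): `energy_floor_sym` / `witness_ceiling_ge_floor_sym`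
  — `‖g‖₂² ≤ M⟨‖u‖²⟩ + (νK/2)(1+⟨‖u‖²⟩)` with the ONE-SIDED strain constant `M` (`-M‖w‖² ≤ ⟪w,∇g(x)w⟫`,
  i.e. `M = ‖sym∇g‖_∞` for divergence-free planar `g`) in place of `D = ‖∑ᵢ‖∂ᵢg‖‖_∞`; any witness
  family has `E ≥ ‖g‖₂²/M` (Kolmogorov `sin(2πk_f x₁)e₀`, `‖g‖₂² = ½`: `E ≥ 1/(2πk_f)`).
* Not formalised (why it resists):
  - THE RANDOM ANALOGUE IS FALSE, AND SHOWS WHAT A WITNESS MUST DO (gen 2, literature).  For the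
    2-D Navier–Stokes system on `𝕋²` driven by a spatially smooth WHITE-IN-TIME force of fixed
    amplitude, `∂ₜu + νLu + B(u) = ν^a η` with `a < 1/2` (in particular `a = 0`), the stationary
    measures have NO weak accumulation point on `H` as `ν → 0⁺` — energies are not tight
    (Kuksin–Shirikyan 2012, *Mathematics of Two-Dimensional Turbulence*, Thm 5.2.17 (ii), PDF
    p. 233; only the scaling `√ν η` has non-trivial limits, with the two-sided energy bound (5.7)
    `𝔅₀²/(2𝔅₁) ≤ E|u|₂² ≤ 𝔅₀/2`, p. 208).  Reason: Itô fixes the injection, `E⟨Lu,u⟩ = 𝔅₀/2ν`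
    cannot detune.  A deterministic steady `g` differs in exactly one respect: the injection
    `⟨(g, v)⟩` is dynamical and CAN be detuned to `O(ν)` (it must be, at bounded energy: 2-D energy
    equality + Alexakis–Doering), while the Reynolds stress keeps supplying `‖g‖₂²` (§E floor).  So
    every witness of the crux is a DETUNING MECHANISM at zero momentum — the condensate sweeping of
    Gallet–Young — and nothing else; a disproof would have to show detuning to `O(ν)` is
    dynamically impossible for every `g`, which no known estimate does.
  - BALANCE LAWS CANNOT KILL IT.  Testing the weak formulation with `g` itself and averaging in
    time gives, for any admissible family with `⟨‖v_j‖²⟩ ≤ E`,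
    `⟨⟨v_j ⊗ v_j, ∇g⟩⟩ = -‖g‖₂² + O(ν_j ‖Δg‖₂ √E)`, hence only the O(1) ENERGY FLOOR
    `⟨‖v_j‖²⟩ ≥ ‖g‖₂²/‖∇g‖_∞ - O(ν_j)` (a witness cannot be small) — no growth in `ν⁻¹`.
    The sweeping heuristic of Gallet–Young 2013 closes the budget ν-independently: a first-shell
    condensate of amplitude `U` advects the forcing-scale response into near-quadrature with `g`,
    injection `⟨g,v⟩ ~ ν‖g‖²λ_f/(λ_f U²)·const`, large-scale dissipation `~ νλ₁U²`, so
    `U⁴ ~ ‖g‖²/λ₁` with BOTH sides `O(ν)`: the vortex-condensate analogue of the Galilean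
    detuning of stmt-0209, now at zero momentum.  DNS confirms a condensate "with bounded
    amplitude as viscosity vanishes" (CTV2013 p. 3 reporting GY2013).  A disproof would have to
    exclude this regime for EVERY `g`, against the numerics; a proof would have to construct it
    (nonlinear stability of a turbulent condensate) — the printed open problem either way.
  - For single-shell `g` at ANY shell the Tran–Shepherd pincer `‖∇u‖² ≤ λ‖u‖²` bounds enstrophy
    by energy (planar dissipation `≤ νλE → 0`: such a witness is useless for the ROUTE, whose
    design rule is `g` on ≥ 2 shells), but gives no bound on the energy — Kolmogorov forcing
    `n ≥ 2` at zero momentum is neither refuted nor proved (CTV2013 §2: the laminar branch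
    `g/(νλ_n)`, energy `∝ ν⁻²`, is an exact zero-momentum solution, so the `∀`-data
    strengthening is false at every shell, while bounded-energy data are unknown).
  - No cheap TRUE witness: every explicit solution in the class (single shell; parallel or
    orthogonal shears `(P(x₁), Q(x₀))`; CTV's two-shear steady Euler states `u₁ + u₂` with
    `B(u,u) = f`) needs force amplitude `∝ ν × state` on its shear modes, i.e. energy `∝ ν⁻²`
    at fixed `g`; steady bounded families `νAu_ν + B(u_ν,u_ν) = g`, `‖u_ν‖₂ = O(1)` would
    converge to steady Euler states `B(u⁰,u⁰) = g` and are themselves the open problem.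
  - (gen 1 note, now CLOSED by §F:) Marchioro rigidity for the whole first eigenspace — ANY
    witness needs a mode with `|k|² ≥ 2` — is formalised in `Negative/FirstShellGeneral.lean`.

LANDED (importable by ideators / planners / leads), namespace
`Summit.AnomalousDissipation.AnomalousDissipation.Theorems.TwodBoundedEnergyZeroMomentum.Negative`:
* `…/Theorems/TwodBoundedEnergyZeroMomentum/Negative/FirstShellRigidity.lean` (p72903): §0, §B
  (`meanEnergy_eq_of_firstMode`, `not_TwodBoundedEnergyZeroMomentum_firstMode`), §C
  (`not_TwodBoundedEnergyZeroMomentum_forall_force`), §D (`hasZeroMean_slice`,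
  `meanEnergy_le_apriori`);
* `…/Negative/LoadBearing.lean` (p74024): §A as
  `twodBoundedEnergyZeroMomentum_holds_without_{zeroMomentum,vanishingViscosity,nonzeroForce}`;
* `…/Negative/EnergyFloor.lean` (p74455): §E (`integral_norm_sq_le_affine`, `energy_floor`,
  `witness_ceiling_ge_floor`);
* gen 2: `…/Negative/FirstShellGalerkin.lean` (p75960), `…/Negative/FirstShellTrilinear.lean` (p76427),
  `…/Negative/FirstShellGeneral.lean` (p76654) (§F: `exists_lerayHopf_enstrophyExcess_tendsto_zero_of_firstShell`,
  `bound_and_enstrophyExcess_tendsto_zero_of_firstShell`, `abs_integral_inner_convect_firstShell_le_sqrt`,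
  `meanEnergy_ge_of_firstShell`, `not_TwodBoundedEnergyZeroMomentum_firstShell`,
  `exists_mode_two_le_of_witness`, `integral_norm_sq_ge_of_steady_firstShell`,
  `not_boundedSteadyBranch_firstShell`, `meanEnergy_const`);
  `…/Negative/SteadyShellIdentity.lean` (p76689) (§G: `steady_convect_eq`, `steady_energy_identity`,
  `steady_work_nonneg`, `steady_enstrophy_identity`, `steady_laplacian_sq_eq_of_stokesEigenforce`,
  `steady_laplacian_sq_eq_of_firstShell`, `steady_hasSum_straddle`,
  `steady_no_subshell_mode_of_no_supershell_mode`, Parseval helpers);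
  `…/Negative/SteadyScaling.lean` (p77269) (§H: `steady_smul`, `boundedSteadyBranch_smul`);
  `…/Negative/SteadyBounds.lean` (p77406) (§H: `steady_firstShell_energy_le_supershell_palinstrophy`,
  `gradNormSq_sq_le_of_isSmooth`, `steady_work_sq_le`, `steady_sobolev_bounds_of_stokesEigenforce`);
  `…/Negative/EnergyFloorSym.lean` (p77468) (§H': `energy_floor_sym`, `witness_ceiling_ge_floor_sym`);
  `…/Negative/SteadyCondensateNecessary.lean` (p77981) (§H'': `laplacian_of_shellSupported`,
  `integral_norm_sq_pos_of_ne_zero`, `steady_laminar_of_no_subshell_mode`, `steady_energy_eq_of_no_subshell_mode`,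
  `not_boundedSteadyBranch_singleShell_noSubshell`).
-/

noncomputable section

open MeasureTheory Set Filter Topology UnitAddTorus
open scoped ENNReal NNReal InnerProductSpace RealInnerProductSpace ComplexConjugate

namespace Summit.AnomalousDissipation.AnomalousDissipation.Cruxes.TwodBoundedEnergyZeroMomentum.Disproof

open Literature.Analysis.FunctionSpaces Literature.Analysis.FunctionSpaces.Torus
open Literature.Analysis.FluidPDE Literature.Analysis.FluidPDE.Torus
open Literature.Barriers.AnomalousDissipation

/-- The flat two-torus (local notation). -/
local notation "𝕋²" => UnitAddTorus (Fin 2)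
/-- Velocity values (local notation). -/
local notation "E²" => EuclideanSpace ℝ (Fin 2)
/-- Frequencies (local notation). -/
local notation "ℤ²" => Fin 2 → ℤ

/-! ## §0 Tools: Cesàro means of convergent observables; `L²` convergence of energies -/

section Cesaro

/-- **Cesàro**: if `g` is integrable on every `(0, T]` and `g(t) → L` as `t → ∞`, then the
running means `T⁻¹ ∫₀ᵀ g → L`. [folklore] -/
theorem tendsto_timeMean_of_tendsto {g : ℝ → ℝ} {L : ℝ}
    (hint : ∀ T, 0 < T → IntegrableOn g (Ioc 0 T)) (hg : Tendsto g atTop (𝓝 L)) :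
    Tendsto (timeMean g) atTop (𝓝 L) := by
  rw [Metric.tendsto_atTop]
  intro ε hε
  obtain ⟨t₁, ht₁⟩ := Metric.tendsto_atTop.1 hg (ε / 2) (half_pos hε)
  set t₀ : ℝ := max t₁ 1 with ht₀_def
  have ht₀1 : 1 ≤ t₀ := le_max_right _ _
  have ht₀0 : 0 < t₀ := one_pos.trans_le ht₀1
  have hclose : ∀ t, t₀ ≤ t → |g t - L| < ε / 2 := fun t ht => by
    have := ht₁ t ((le_max_left _ _).trans ht)
    rwa [Real.dist_eq] at this
  -- interval integrability on `[a, b]`, `0 ≤ a ≤ b`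
  have hii : ∀ a b, 0 ≤ a → a ≤ b → IntervalIntegrable g volume a b := by
    intro a b ha hab
    rcases eq_or_lt_of_le hab with rfl | hlt
    · exact IntervalIntegrable.refl
    · rw [intervalIntegrable_iff_integrableOn_Ioc_of_le hab]
      exact (hint b (ha.trans_lt hlt)).mono_set (Ioc_subset_Ioc_left ha)
  have hiiL : ∀ a b, 0 ≤ a → a ≤ b → IntervalIntegrable (fun t => g t - L) volume a b :=
    fun a b ha hab => (hii a b ha hab).sub _root_.intervalIntegrable_const
  set C : ℝ := ∫ t in (0 : ℝ)..t₀, |g t - L| with hC_def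
  have hC0 : 0 ≤ C := intervalIntegral.integral_nonneg ht₀0.le fun t _ => abs_nonneg _
  refine ⟨max t₀ (2 * C / ε + 1), fun T hT => ?_⟩
  have hTt₀ : t₀ ≤ T := (le_max_left _ _).trans hT
  have hT0 : 0 < T := ht₀0.trans_le hTt₀
  have hTC : 2 * C / ε < T := by
    have := (le_max_right _ _).trans hT
    linarith
  -- `timeMean g T - L = T⁻¹ ∫₀ᵀ (g - L)`
  have hmean : timeMean g T - L = T⁻¹ * ∫ t in (0 : ℝ)..T, (g t - L) := by
    rw [timeMean, intervalIntegral.integral_sub (hii 0 T le_rfl hT0.le) _root_.intervalIntegrable_const,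
      intervalIntegral.integral_const, sub_zero, smul_eq_mul, mul_sub, inv_mul_cancel_left₀ hT0.ne']
  -- split at `t₀`
  have hsplit : ∫ t in (0 : ℝ)..T, (g t - L) =
      (∫ t in (0 : ℝ)..t₀, (g t - L)) + ∫ t in t₀..T, (g t - L) :=
    (intervalIntegral.integral_add_adjacent_intervals (hiiL 0 t₀ le_rfl ht₀0.le)
      (hiiL t₀ T ht₀0.le hTt₀)).symm
  have h1 : |∫ t in (0 : ℝ)..t₀, (g t - L)| ≤ C := by
    rw [hC_def]
    have := intervalIntegral.norm_integral_le_integral_norm (μ := volume)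
      (f := fun t => g t - L) ht₀0.le
    simpa only [Real.norm_eq_abs] using this
  have h2 : |∫ t in t₀..T, (g t - L)| ≤ (T - t₀) * (ε / 2) := by
    have hn := intervalIntegral.norm_integral_le_integral_norm (μ := volume)
      (f := fun t => g t - L) hTt₀
    simp only [Real.norm_eq_abs] at hn
    refine hn.trans ?_
    have hmono : ∫ t in t₀..T, |g t - L| ≤ ∫ _ in t₀..T, ε / 2 :=
      intervalIntegral.integral_mono_on hTt₀ (hiiL t₀ T ht₀0.le hTt₀).abs
        _root_.intervalIntegrable_const fun t ht => (hclose t ht.1).le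
    rw [intervalIntegral.integral_const, smul_eq_mul] at hmono
    exact hmono
  have h3 : |∫ t in (0 : ℝ)..T, (g t - L)| ≤ C + T * (ε / 2) := by
    rw [hsplit]
    refine (abs_add_le _ _).trans ?_
    have : (T - t₀) * (ε / 2) ≤ T * (ε / 2) := by nlinarith
    linarith
  have hCT : C / T < ε / 2 := by
    rw [div_lt_iff₀ hT0]
    rw [div_lt_iff₀ hε] at hTC
    linarith
  rw [Real.dist_eq, hmean, abs_mul, abs_inv, abs_of_pos hT0]
  calc T⁻¹ * |∫ t in (0 : ℝ)..T, (g t - L)| ≤ T⁻¹ * (C + T * (ε / 2)) := by gcongr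
    _ = C / T + ε / 2 := by field_simp
    _ < ε / 2 + ε / 2 := by linarith
    _ = ε := by ring

/-- The long-time average (`limsup` of Cesàro means) of a convergent, locally integrable
observable is its limit. [folklore] -/
theorem longTimeAvgSup_eq_of_tendsto {g : ℝ → ℝ} {L : ℝ}
    (hint : ∀ T, 0 < T → IntegrableOn g (Ioc 0 T)) (hg : Tendsto g atTop (𝓝 L)) :
    longTimeAvgSup g = L :=
  (tendsto_timeMean_of_tendsto hint hg).limsup_eq

end Cesaro

section L2

variable {X : Type*} [MeasureSpace X] {F : Type*} [NormedAddCommGroup F]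

/-- For `f ∈ L²`, `‖f‖_{L²}² = ∫ ‖f‖²` (real form). [folklore] -/
theorem toReal_eLpNorm_sq_eq_integral_norm_sq {f : X → F} (hf : MemLp f 2 volume) :
    (eLpNorm f 2 volume).toReal ^ 2 = ∫ x, ‖f x‖ ^ 2 := by
  have hsq : eLpNorm f 2 volume ^ 2 = ∫⁻ x, ‖f x‖ₑ ^ 2 := by
    rw [eLpNorm_eq_lintegral_rpow_enorm_toReal two_ne_zero ENNReal.ofNat_ne_top]
    simp only [ENNReal.toReal_ofNat, one_div]
    rw [← ENNReal.rpow_natCast, ← ENNReal.rpow_mul]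
    norm_num
  have hrhs : ENNReal.ofReal (∫ x, ‖f x‖ ^ 2) = ∫⁻ x, ‖f x‖ₑ ^ 2 := by
    rw [ofReal_integral_eq_lintegral_ofReal (hf.integrable_norm_pow two_ne_zero)
      (ae_of_all _ fun x => by positivity)]
    refine lintegral_congr fun x => ?_
    rw [← ofReal_norm, ← ENNReal.ofReal_pow (norm_nonneg _)]
  rw [← ENNReal.toReal_pow, hsq, ← hrhs, ENNReal.toReal_ofReal (integral_nonneg fun _ => sq_nonneg _)]

/-- **`L²` convergence implies convergence of the energies**: if `u i → w` in `L²` along a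
filter, then `∫ ‖u i‖² → ∫ ‖w‖²`. [folklore] -/
theorem tendsto_integral_norm_sq_of_tendsto_eLpNorm {ι : Type*} {l : Filter ι} {u : ι → X → F}
    {w : X → F} (hu : ∀ᶠ i in l, MemLp (u i) 2 volume) (hw : MemLp w 2 volume)
    (h : Tendsto (fun i => eLpNorm (u i - w) 2 volume) l (𝓝 0)) :
    Tendsto (fun i => ∫ x, ‖u i x‖ ^ 2) l (𝓝 (∫ x, ‖w x‖ ^ 2)) := by
  set A : ι → ℝ := fun i => (eLpNorm (u i) 2 volume).toReal with hA
  set B : ℝ := (eLpNorm w 2 volume).toReal with hB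
  set D : ι → ℝ := fun i => (eLpNorm (u i - w) 2 volume).toReal with hD
  have hD0 : Tendsto D l (𝓝 0) := by
    have := (ENNReal.tendsto_toReal ENNReal.zero_ne_top).comp h
    rw [ENNReal.toReal_zero] at this
    exact this
  have hwfin : eLpNorm w 2 volume ≠ ⊤ := hw.eLpNorm_ne_top
  -- two triangle inequalities, in real form
  have htri : ∀ᶠ i in l, B - D i ≤ A i ∧ A i ≤ B + D i := by
    filter_upwards [hu] with i hui
    have hufin : eLpNorm (u i) 2 volume ≠ ⊤ := hui.eLpNorm_ne_top
    have hdfin : eLpNorm (u i - w) 2 volume ≠ ⊤ := (hui.sub hw).eLpNorm_ne_top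
    have h1 : eLpNorm (u i) 2 volume ≤ eLpNorm (u i - w) 2 volume + eLpNorm w 2 volume := by
      have heq : u i = (u i - w) + w := (sub_add_cancel _ _).symm
      conv_lhs => rw [heq]
      exact eLpNorm_add_le (hui.1.sub hw.1) hw.1 one_le_two
    have h2 : eLpNorm w 2 volume ≤ eLpNorm (w - u i) 2 volume + eLpNorm (u i) 2 volume := by
      have heq : w = (w - u i) + u i := (sub_add_cancel _ _).symm
      conv_lhs => rw [heq]
      exact eLpNorm_add_le (hw.1.sub hui.1) hui.1 one_le_two
    rw [eLpNorm_sub_comm] at h2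
    constructor
    · have := ENNReal.toReal_mono (ENNReal.add_ne_top.2 ⟨hdfin, hufin⟩) h2
      rw [ENNReal.toReal_add hdfin hufin] at this
      simp only [hA, hB, hD]
      linarith
    · have := ENNReal.toReal_mono (ENNReal.add_ne_top.2 ⟨hdfin, hwfin⟩) h1
      rw [ENNReal.toReal_add hdfin hwfin] at this
      simpa only [hA, hB, hD, add_comm] using this
  have hAB : Tendsto A l (𝓝 B) := by
    have hlow : Tendsto (fun i => B - D i) l (𝓝 B) := by
      simpa using (tendsto_const_nhds (x := B)).sub hD0
    have hup : Tendsto (fun i => B + D i) l (𝓝 B) := by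
      simpa using (tendsto_const_nhds (x := B)).add hD0
    exact tendsto_of_tendsto_of_tendsto_of_le_of_le' hlow hup (htri.mono fun i hi => hi.1)
      (htri.mono fun i hi => hi.2)
  have hsq := hAB.pow 2
  rw [hB, toReal_eLpNorm_sq_eq_integral_norm_sq hw] at hsq
  refine hsq.congr' ?_
  filter_upwards [hu] with i hui
  rw [hA]
  exact toReal_eLpNorm_sq_eq_integral_norm_sq hui

end L2

/-! ## §B Tightness / rigidity at the first shell: the laminar energy `α²/(16π⁴ν²)` is forced -/

section FirstMode

/-- **Energy of the first-mode force**: `∫ ‖f_β‖² = β²` (`f_β = β√2 sin(2πx₀) e₁`). [folklore] -/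
theorem integral_norm_sq_marchioroForce (β : ℝ) : ∫ x, ‖marchioroForce β x‖ ^ 2 = β ^ 2 := by
  have hrepr : marchioroForce β = realTrigPoly (freqBall 1) (marchioroForceCoeff β) := by
    rw [← fourierTruncate_marchioroForce β le_rfl, fourierTruncate_eq]
    rfl
  have hpair : ({firstModeFreq, -firstModeFreq} : Finset ℤ²) ⊆ freqBall 1 := by
    intro k hk
    simp only [Finset.mem_insert, Finset.mem_singleton] at hk
    rw [mem_freqBall, Nat.cast_one, one_pow]
    rcases hk with rfl | rfl
    · rw [freqNormSq_firstModeFreq]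
    · rw [freqNormSq_neg, freqNormSq_firstModeFreq]
  rw [hrepr, integral_norm_sq_realTrigPoly neg_mem_freqBall_one (isConjSymm_marchioroForceCoeff β),
    ← Finset.sum_subset hpair fun k _ hk => ?_]
  · rw [Finset.sum_pair firstModeFreq_ne_neg, marchioroForceCoeff_eq, marchioroForceCoeff_eq,
      if_pos rfl, if_neg firstModeFreq_ne_neg, if_neg (Ne.symm firstModeFreq_ne_neg), if_pos rfl,
      EuclideanSpace.conjVec_zero, add_zero, zero_add, norm_smul, norm_smul,
      EuclideanSpace.norm_conjVec, norm_inv, Complex.norm_ofNat, mul_pow, norm_sq_firstModeCoeff]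
    ring
  · simp only [Finset.mem_insert, Finset.mem_singleton, not_or] at hk
    rw [marchioroForceCoeff_eq_zero hk.1 hk.2, norm_zero, zero_pow two_ne_zero]

/-- **Energy of the laminar state**: `∫ ‖ū‖² = α²/(16π⁴ν²)`, `ū = f_α/(4π²ν)`. [folklore] -/
theorem integral_norm_sq_marchioroLaminarState (α ν : ℝ) :
    ∫ x, ‖marchioroLaminarState α ν x‖ ^ 2 = α ^ 2 / (16 * Real.pi ^ 4 * ν ^ 2) := by
  rw [marchioroLaminarState_eq_marchioroForce, integral_norm_sq_marchioroForce]
  rcases eq_or_ne ν 0 with rfl | hν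
  · simp
  · field_simp
    ring

variable {α ν : ℝ} {u₀ : 𝕋² → E²} {u : ℝ → 𝕋² → E²}

/-- **The energy of every zero-momentum Leray–Hopf solution under the first-mode force
converges to the laminar energy** `α²/(16π⁴ν²)` as `t → ∞` (Marchioro 1986 / FMRT App. III.A.4
via `Marchioro1986_globalAttraction_holds`, plus `L²`-continuity of the energy). [folklore] -/
theorem tendsto_integral_norm_sq_of_firstMode (hν : 0 < ν) (hu₀ : MemLp u₀ 2 volume)
    (hmean : HasZeroMean u₀)
    (hu : Torus.IsGlobalLerayHopf ν (fun _ => marchioroForce α) u₀ u) :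
    Tendsto (fun t => ∫ x, ‖u t x‖ ^ 2) atTop (𝓝 (α ^ 2 / (16 * Real.pi ^ 4 * ν ^ 2))) := by
  have hM := Marchioro1986_globalAttraction_holds α ν hν u₀ hu₀ hu.isWeaklyDivFree_datum hmean u hu
  rw [← integral_norm_sq_marchioroLaminarState α ν]
  refine tendsto_integral_norm_sq_of_tendsto_eLpNorm ?_ (memLp_marchioroLaminarState α ν 2) hM
  filter_upwards [eventually_ge_atTop 0] with t ht
  exact hu.memLp_two ht

/-- **Mean energy at the first shell is exactly the laminar one**: for every zero-momentum
global Leray–Hopf solution with force `marchioroForce α` and viscosity `ν > 0`,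
`⟨‖u‖²⟩ = α²/(16π⁴ν²)`. TIGHTNESS LEMMA: at fixed first-shell `g = f_α` the mean energy of the
crux's admissible families is `∝ ν⁻²`, with no freedom in the data. [folklore] -/
theorem meanEnergy_eq_of_firstMode (hν : 0 < ν) (hu₀ : MemLp u₀ 2 volume)
    (hmean : HasZeroMean u₀)
    (hu : Torus.IsGlobalLerayHopf ν (fun _ => marchioroForce α) u₀ u) :
    meanEnergy u = α ^ 2 / (16 * Real.pi ^ 4 * ν ^ 2) := by
  rw [meanEnergy_eq_longTimeAvgSup]
  exact longTimeAvgSup_eq_of_tendsto (fun T hT => hu.integrableOn_integral_norm_sq hT)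
    (tendsto_integral_norm_sq_of_firstMode hν hu₀ hmean hu)

/-- **The crux restricted to first-shell forces is FALSE.** For `g = marchioroForce α`, `α ≠ 0`
(a first Stokes eigenfunction, the force named in the crux docstring), NO choice of
viscosities `ν_j → 0` and zero-momentum `L²` data yields Leray–Hopf solutions with bounded mean
energy: `⟨‖v_j‖²⟩ = α²/(16π⁴ν_j²) → ∞`. Refutation of the natural special case / of the
strengthening "the witness force may be taken in the first shell". [folklore] -/
theorem not_crux_firstMode :
    ¬ ∃ α : ℝ, α ≠ 0 ∧ ∃ (ν : ℕ → ℝ) (v₀ : ℕ → 𝕋² → E²) (v : ℕ → ℝ → 𝕋² → E²),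
      (∀ j, 0 < ν j) ∧ Tendsto ν atTop (𝓝 0) ∧
      (∀ j, MemLp (v₀ j) 2 volume ∧ HasZeroMean (v₀ j)) ∧
      (∀ j, Torus.IsGlobalLerayHopf (ν j) (fun _ => marchioroForce α) (v₀ j) (v j)) ∧
      ∃ E : ℝ, ∀ j, meanEnergy (v j) ≤ E := by
  rintro ⟨α, hα, ν, v₀, v, hν, hν0, hdata, hLH, E, hE⟩
  have hEj : ∀ j, α ^ 2 / (16 * Real.pi ^ 4 * ν j ^ 2) ≤ E := fun j => by
    rw [← meanEnergy_eq_of_firstMode (hν j) (hdata j).1 (hdata j).2 (hLH j)]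
    exact hE j
  have hE0 : 0 < E := by
    have h0 : 0 < α ^ 2 / (16 * Real.pi ^ 4 * ν 0 ^ 2) := by
      have := hν 0
      positivity
    exact h0.trans_le (hEj 0)
  -- `ν_j² ≥ α²/(16π⁴E)` contradicts `ν_j → 0`
  have hlow : ∀ j, α ^ 2 / (16 * Real.pi ^ 4 * E) ≤ ν j ^ 2 := fun j => by
    have h1 := hEj j
    have hνj := hν j
    rw [div_le_iff₀ (by positivity)] at h1
    rw [div_le_iff₀ (by positivity)]
    nlinarith
  have hsq : Tendsto (fun j => ν j ^ 2) atTop (𝓝 0) := by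
    simpa using hν0.pow 2
  have hc : 0 < α ^ 2 / (16 * Real.pi ^ 4 * E) := by positivity
  have hev := (tendsto_order.1 hsq).2 _ hc
  obtain ⟨j, hj⟩ := hev.exists
  exact absurd (hlow j) (not_le.2 hj)

end FirstMode

/-! ## §C A false strengthening: bounded energy for EVERY admissible force -/

section Strengthening

/-- **The `∀ g` strengthening of the crux is false**: it is NOT the case that every smooth,
divergence-free, mean-zero `g ≠ 0` admits a zero-momentum bounded-mean-energy Leray–Hopf family
along some `ν_j → 0` — the first-mode force is a counterexample (`not_crux_firstMode`). So the
existential over `g` in the crux is essential: the witness force must be CHOSEN (off the first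
shell). [folklore] -/
theorem not_crux_forall_force :
    ¬ ∀ g : 𝕋² → E², IsSmooth g → IsDivFree g → HasZeroMean g → g ≠ 0 →
      ∃ (ν : ℕ → ℝ) (v₀ : ℕ → 𝕋² → E²) (v : ℕ → ℝ → 𝕋² → E²),
        (∀ j, 0 < ν j) ∧ Tendsto ν atTop (𝓝 0) ∧
        (∀ j, MemLp (v₀ j) 2 volume ∧ HasZeroMean (v₀ j)) ∧
        (∀ j, Torus.IsGlobalLerayHopf (ν j) (fun _ => g) (v₀ j) (v j)) ∧
        ∃ E : ℝ, ∀ j, meanEnergy (v j) ≤ E := by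
  intro h
  have hdiv : IsDivFree (marchioroForce 1) := by
    rw [marchioroForce_eq_realTrigPoly]
    exact isDivFree_realTrigPoly_singleton (sum_mul_firstModeCoeff 1)
  have hmean : HasZeroMean (marchioroForce 1) :=
    hasZeroMean_stokesMode (k := Pi.single 0 1) firstModeFreq_ne_zero _ _
  obtain ⟨ν, v₀, v, hν, hν0, hdata, hLH, hE⟩ :=
    h (marchioroForce 1) (isSmooth_marchioroForce 1) hdiv hmean (marchioroForce_ne_zero one_ne_zero)
  exact not_crux_firstMode ⟨1, one_ne_zero, ν, v₀, v, hν, hν0, hdata, hLH, hE⟩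

end Strengthening


/-! ## §A Load-bearing constraints of the existential crux

For an EXISTENTIAL statement the load-bearing analysis reads: which constraint keeps the cheap
witnesses out?  Each `CruxWithout…` below is the crux with ONE constraint deleted, and each is
PROVED — by an explicit laminar / Galilean-swept state with no turbulence content.  So a proof of
the crux must use all three constraints at once: the witness has to be a genuinely non-laminar,
zero-momentum object along `ν_j → 0` (the condensate regime, Gallet–Young 2013, DNS only). -/

section LoadBearing

variable {α ν : ℝ}

/-- The first-mode force is admissible for the crux: smooth, divergence free, mean zero. [folklore] -/
theorem marchioroForce_admissible (α : ℝ) :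
    IsSmooth (marchioroForce α) ∧ IsDivFree (marchioroForce α) ∧ HasZeroMean (marchioroForce α) := by
  refine ⟨isSmooth_marchioroForce α, ?_, ?_⟩
  · rw [marchioroForce_eq_realTrigPoly]
    exact isDivFree_realTrigPoly_singleton (sum_mul_firstModeCoeff α)
  · exact hasZeroMean_stokesMode (k := Pi.single 0 1) firstModeFreq_ne_zero _ _

/-- At zero momentum the sweep rate of a non-zero mode has modulus `≥ 4π²ν`. [folklore] -/
theorem le_norm_sweepRate_zero (hν : 0 ≤ ν) {k : ℤ²} (hk : k ≠ 0) :
    4 * Real.pi ^ 2 * ν ≤ ‖sweepRate ν 0 k‖ := by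
  have h1 : |(sweepRate ν 0 k).re| ≤ ‖sweepRate ν 0 k‖ := Complex.abs_re_le_norm _
  rw [re_sweepRate] at h1
  have h2 : 1 ≤ freqNormSq k := Literature.Analysis.FluidPDE.one_le_freqNormSq_of_ne_zero hk
  have h3 : 4 * Real.pi ^ 2 * ν ≤ ν * (4 * Real.pi ^ 2 * freqNormSq k) := by
    calc 4 * Real.pi ^ 2 * ν = ν * (4 * Real.pi ^ 2 * 1) := by ring
      _ ≤ ν * (4 * Real.pi ^ 2 * freqNormSq k) := by gcongr
  exact h3.trans ((le_abs_self _).trans h1)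

/-- Zero-momentum swept coefficients: `‖ĉ(t)(k)‖ ≤ ‖f̂_α(k)‖/(2π²ν)` (`k ≠ 0`, `t ≥ 0`, `ν > 0`)
— NO detuning: the response is the full laminar one, `∝ ν⁻¹`. [folklore] -/
theorem norm_sweptCoeff_zero_le (hν : 0 < ν) {t : ℝ} (ht : 0 ≤ t) {k : ℤ²} (hk : k ≠ 0) :
    ‖sweptCoeff α ν 0 t k‖ ≤ (2 * Real.pi ^ 2 * ν)⁻¹ * ‖marchioroForceCoeff α k‖ := by
  rw [sweptCoeff_of_ne_zero α ν 0 t hk, norm_smul]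
  refine mul_le_mul_of_nonneg_right ?_ (norm_nonneg _)
  rw [sweepFactor, norm_div]
  have hΛ := le_norm_sweepRate_zero hν.le hk
  calc ‖1 - Complex.exp (-(sweepRate ν 0 k * t))‖ / ‖sweepRate ν 0 k‖
      ≤ 2 / (4 * Real.pi ^ 2 * ν) :=
        div_le_div₀ zero_le_two (norm_one_sub_exp_le (re_sweepRate_nonneg hν.le 0 k) ht)
          (by positivity) hΛ
    _ = (2 * Real.pi ^ 2 * ν)⁻¹ := by
        field_simp
        ring

/-- **Energy of the laminar spin-up from rest** (`marchioroSweptState α ν 0`, datum `0`, zero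
momentum): `∫ ‖u(t)‖² ≤ α²/(2π⁴ν²)` for `t ≥ 0` — bounded at fixed `ν`, of laminar size `ν⁻²`. [folklore] -/
theorem integral_norm_sq_marchioroSweptState_zero_le (hν : 0 < ν) {t : ℝ} (ht : 0 ≤ t) :
    ∫ x, ‖marchioroSweptState α ν 0 t x‖ ^ 2 ≤ α ^ 2 / (2 * Real.pi ^ 4 * ν ^ 2) := by
  rw [integral_norm_sq_marchioroSweptState, ← Finset.add_sum_erase _ _ (zero_mem_freqBall 1),
    sweptCoeff_zero_freq, EuclideanSpace.norm_complexify, norm_zero, zero_pow two_ne_zero, zero_add]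
  calc ∑ k ∈ (freqBall 1).erase 0, ‖sweptCoeff α ν 0 t k‖ ^ 2
      ≤ ∑ k ∈ (freqBall 1).erase 0, ((2 * Real.pi ^ 2 * ν)⁻¹ * ‖marchioroForceCoeff α k‖) ^ 2 :=
        Finset.sum_le_sum fun k hk =>
          pow_le_pow_left₀ (norm_nonneg _)
            (norm_sweptCoeff_zero_le hν ht (Finset.ne_of_mem_erase hk)) 2
    _ = (2 * Real.pi ^ 2 * ν)⁻¹ ^ 2 * ∑ k ∈ (freqBall 1).erase 0, ‖marchioroForceCoeff α k‖ ^ 2 := by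
        rw [Finset.mul_sum]
        exact Finset.sum_congr rfl fun k _ => by ring
    _ ≤ (2 * Real.pi ^ 2 * ν)⁻¹ ^ 2 * (2 * α ^ 2) := by
        gcongr
        exact sum_norm_sq_marchioroForceCoeff_le α _
    _ = α ^ 2 / (2 * Real.pi ^ 4 * ν ^ 2) := by
        field_simp

/-- Mean energy of the laminar spin-up from rest: `⟨‖u‖²⟩ ≤ α²/(2π⁴ν²)`. [folklore] -/
theorem meanEnergy_marchioroSweptState_zero_le (hν : 0 < ν) :
    meanEnergy (marchioroSweptState α ν 0) ≤ α ^ 2 / (2 * Real.pi ^ 4 * ν ^ 2) :=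
  meanEnergy_le_of_forall_le fun _ ht => integral_norm_sq_marchioroSweptState_zero_le hν ht.le

/-- The zero field on `𝕋²` has zero mean. [folklore] -/
theorem hasZeroMean_zero : HasZeroMean (fun _ : 𝕋² => (0 : E²)) := by
  simp [HasZeroMean]

/-- The crux with the ZERO-MOMENTUM clause `HasZeroMean (v₀ j)` deleted (= the retired item
TwodBoundedEnergy, stmt-AnomalousDissipation-0209, up to the harmless `MemLp` clause). -/
def CruxWithoutZeroMomentum : Prop :=
  ∃ g : 𝕋² → E², IsSmooth g ∧ IsDivFree g ∧ HasZeroMean g ∧ g ≠ 0 ∧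
    ∃ (ν : ℕ → ℝ) (v₀ : ℕ → 𝕋² → E²) (v : ℕ → ℝ → 𝕋² → E²),
      (∀ j, 0 < ν j) ∧ Tendsto ν atTop (𝓝 0) ∧ (∀ j, MemLp (v₀ j) 2 volume) ∧
      (∀ j, Torus.IsGlobalLerayHopf (ν j) (fun _ => g) (v₀ j) (v j)) ∧
      ∃ E : ℝ, ∀ j, meanEnergy (v j) ≤ E

/-- **Zero momentum is load-bearing**: without it the crux HOLDS, by Galilean sweeping of the
first-mode laminar state (datum `≡ e₀`, `⟨‖v_j‖²⟩ ≤ 1 + 2/π²` uniformly in `ν_j = 1/(j+1)`;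
the tree's `marchioroSweptState`). Any proof of the crux must therefore exploit a mechanism that
survives at total momentum zero. [folklore] -/
theorem cruxWithoutZeroMomentum_holds : CruxWithoutZeroMomentum := by
  set m : E² := EuclideanSpace.single 0 1 with hm_def
  have hm : m 0 ≠ 0 := by simp [hm_def]
  have hν : ∀ j : ℕ, (0 : ℝ) < 1 / ((j : ℝ) + 1) := fun j => by positivity
  obtain ⟨hs, hd, hz⟩ := marchioroForce_admissible 1
  exact ⟨marchioroForce 1, hs, hd, hz, marchioroForce_ne_zero one_ne_zero,
    fun j => 1 / ((j : ℝ) + 1), fun _ _ => m, fun j => marchioroSweptState 1 (1 / ((j : ℝ) + 1)) m, hν,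
    tendsto_one_div_add_atTop_nhds_zero_nat, fun _ => memLp_const m,
    fun j => marchioroSweptState_isGlobalLerayHopf_const 1 (hν j) m,
    ⟨‖m‖ ^ 2 + 2 * (1 : ℝ) ^ 2 / (Real.pi ^ 2 * (m 0) ^ 2), fun j =>
      meanEnergy_marchioroSweptState_le (hν j).le hm⟩⟩

/-- The crux with `Tendsto ν atTop (𝓝 0)` deleted. -/
def CruxWithoutVanishingViscosity : Prop :=
  ∃ g : 𝕋² → E², IsSmooth g ∧ IsDivFree g ∧ HasZeroMean g ∧ g ≠ 0 ∧
    ∃ (ν : ℕ → ℝ) (v₀ : ℕ → 𝕋² → E²) (v : ℕ → ℝ → 𝕋² → E²),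
      (∀ j, 0 < ν j) ∧ (∀ j, MemLp (v₀ j) 2 volume ∧ HasZeroMean (v₀ j)) ∧
      (∀ j, Torus.IsGlobalLerayHopf (ν j) (fun _ => g) (v₀ j) (v j)) ∧
      ∃ E : ℝ, ∀ j, meanEnergy (v j) ≤ E

/-- **`ν_j → 0` is load-bearing**: at fixed viscosity (`ν_j = 1`) the laminar spin-up from rest
under the first-mode force is a zero-momentum family with `⟨‖v_j‖²⟩ ≤ 1/(2π⁴)`. [folklore] -/
theorem cruxWithoutVanishingViscosity_holds : CruxWithoutVanishingViscosity := by
  obtain ⟨hs, hd, hz⟩ := marchioroForce_admissible 1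
  refine ⟨marchioroForce 1, hs, hd, hz, marchioroForce_ne_zero one_ne_zero, fun _ => 1,
    fun _ _ => 0, fun _ => marchioroSweptState 1 1 0, fun _ => one_pos,
    fun _ => ⟨memLp_const 0, hasZeroMean_zero⟩,
    fun _ => marchioroSweptState_isGlobalLerayHopf_const 1 one_pos 0,
    ⟨(1 : ℝ) ^ 2 / (2 * Real.pi ^ 4 * (1 : ℝ) ^ 2), fun _ =>
      meanEnergy_marchioroSweptState_zero_le one_pos⟩⟩

/-- The crux with `g ≠ 0` deleted. -/
def CruxWithoutNonzeroForce : Prop :=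
  ∃ g : 𝕋² → E², IsSmooth g ∧ IsDivFree g ∧ HasZeroMean g ∧
    ∃ (ν : ℕ → ℝ) (v₀ : ℕ → 𝕋² → E²) (v : ℕ → ℝ → 𝕋² → E²),
      (∀ j, 0 < ν j) ∧ Tendsto ν atTop (𝓝 0) ∧
      (∀ j, MemLp (v₀ j) 2 volume ∧ HasZeroMean (v₀ j)) ∧
      (∀ j, Torus.IsGlobalLerayHopf (ν j) (fun _ => g) (v₀ j) (v j)) ∧
      ∃ E : ℝ, ∀ j, meanEnergy (v j) ≤ E

/-- **`g ≠ 0` is load-bearing** (trivially): with the amplitude-`0` force the rest state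
(`marchioroSweptState 0 ν 0`, energy `≤ 0`) is a zero-momentum bounded-energy family along
`ν_j = 1/(j+1) → 0`. [folklore] -/
theorem cruxWithoutNonzeroForce_holds : CruxWithoutNonzeroForce := by
  have hν : ∀ j : ℕ, (0 : ℝ) < 1 / ((j : ℝ) + 1) := fun j => by positivity
  obtain ⟨hs, hd, hz⟩ := marchioroForce_admissible 0
  refine ⟨marchioroForce 0, hs, hd, hz, fun j => 1 / ((j : ℝ) + 1), fun _ _ => 0,
    fun j => marchioroSweptState 0 (1 / ((j : ℝ) + 1)) 0, hν,
    tendsto_one_div_add_atTop_nhds_zero_nat, fun _ => ⟨memLp_const 0, hasZeroMean_zero⟩,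
    fun j => marchioroSweptState_isGlobalLerayHopf_const 0 (hν j) 0, ⟨0, fun j => ?_⟩⟩
  have h := meanEnergy_marchioroSweptState_zero_le (α := 0) (hν j)
  simpa using h

end LoadBearing

/-! ## §D Junk audit: the momentum stays zero and the `limsup` is honest -/

section Honest

variable {ν : ℝ} {g u₀ : 𝕋² → E²} {u : ℝ → 𝕋² → E²}

/-- **Momentum stays zero.** Under a smooth mean-zero steady force, zero-momentum `L²` data
give zero-momentum slices at every positive time: constant test fields ARE admissible in the
tree's weak formulation (`Torus.IsGlobalLerayHopf.integral_inner_const_eq`), so no Galilean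
drift is available to a witness of the crux — the repair of stmt-0209 is effective. [folklore] -/
theorem hasZeroMean_slice (hg : IsSmooth g) (hg0 : HasZeroMean g) (hu₀ : MemLp u₀ 2 volume)
    (h0 : HasZeroMean u₀) (hu : Torus.IsGlobalLerayHopf ν (fun _ => g) u₀ u) {t : ℝ}
    (ht : 0 < t) : HasZeroMean (u t) := by
  unfold HasZeroMean at h0 ⊢
  have hti : Integrable (u t) volume := (hu.memLp_two ht.le).integrable one_le_two
  have h0i : Integrable u₀ volume := hu₀.integrable one_le_two
  refine ext_inner_left ℝ fun e => ?_
  have h1 : (fun x => ⟪e, u t x⟫_ℝ) = fun x => ⟪u t x, e⟫_ℝ := funext fun x => real_inner_comm _ _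
  have h2 : (fun x => ⟪u₀ x, e⟫_ℝ) = fun x => ⟪e, u₀ x⟫_ℝ := funext fun x => real_inner_comm _ _
  rw [inner_zero_right, ← integral_inner hti e, h1, hu.integral_inner_const_eq hg hg0 e ht, h2,
    integral_inner h0i e, h0, inner_zero_right]

/-- **The `limsup` is honest** (a priori bound; Doering–Foias 2002 §2 /
`Torus.IsGlobalLerayHopf.timeMean_norm_sq_le` at zero momentum): for every admissible
zero-momentum solution of the crux, `⟨‖u‖²⟩ ≤ ½‖u₀‖²/(2π²ν) + ‖g‖₂²/(16π⁴ν²) < ∞`. Hence the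
clause `meanEnergy (v j) ≤ E` can never hold through the junk value (`limsup = 0` on unbounded
Cesàro means): the content of the crux is exactly the UNIFORMITY in `j`. [folklore] -/
theorem meanEnergy_le_apriori (hν : 0 < ν) (hg : IsSmooth g) (hg0 : HasZeroMean g)
    (hu₀ : MemLp u₀ 2 volume) (h0 : HasZeroMean u₀)
    (hu : Torus.IsGlobalLerayHopf ν (fun _ => g) u₀ u) :
    meanEnergy u ≤ kineticEnergy u₀ / (2 * Real.pi ^ 2 * ν) +
      (∫ x, ‖g x‖ ^ 2) / (16 * Real.pi ^ 4 * ν ^ 2) := by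
  have hmom : ∫ x, u 1 x = 0 := hasZeroMean_slice hg hg0 hu₀ h0 hu one_pos
  have hbound : ∀ T, 1 ≤ T → timeMean (fun t => ∫ x, ‖u t x‖ ^ 2) T ≤
      kineticEnergy u₀ / (2 * Real.pi ^ 2 * ν) + (∫ x, ‖g x‖ ^ 2) / (16 * Real.pi ^ 4 * ν ^ 2) := by
    intro T hT
    have := hu.timeMean_norm_sq_le hν hg hg0 hT
    rw [hmom, norm_zero, zero_pow two_ne_zero, mul_zero, zero_add] at this
    exact this
  rw [meanEnergy_eq_longTimeAvgSup, longTimeAvgSup]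
  refine limsup_le_of_le ?_ ((eventually_ge_atTop 1).mono hbound)
  refine Filter.IsBoundedUnder.isCoboundedUnder_le ⟨0, ?_⟩
  exact (eventually_ge_atTop 0).mono fun T hT =>
    timeMean_nonneg (fun t => integral_nonneg fun _ => sq_nonneg _) hT

end Honest

/-! ## §E Tightness of the ceiling: an `O(1)` energy floor for every witness (balance laws give no more) -/

section Floor

variable {ν : ℝ} {g u₀ : 𝕋² → E²} {u : ℝ → 𝕋² → E²}

/-- **Affine-in-time energy bound** for zero-momentum Leray–Hopf solutions under a smooth
mean-zero steady force: `∫ ‖u(t)‖² ≤ (2 + 1/(2π²ν)) ½‖u₀‖² · 2 … ` — precisely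
`∫ ‖u(t)‖² ≤ (2E₀ + E₀/(2π²ν)) + (‖g‖₂² + ‖g‖₂²/(16π⁴ν²)) t`, `E₀ = ½‖u₀‖₂²` (energy
inequality from `0`, work `⟨g,u⟩ ≤ ½(‖g‖₂² + ‖u‖₂²)`, and the tree's linear bound on
`∫₀ᵗ ‖u‖₂²`). [folklore] -/
theorem integral_norm_sq_le_affine (hν : 0 < ν) (hg : IsSmooth g) (hg0 : HasZeroMean g)
    (hu₀ : MemLp u₀ 2 volume) (h0 : HasZeroMean u₀)
    (hu : Torus.IsGlobalLerayHopf ν (fun _ => g) u₀ u) {t : ℝ} (ht : 0 < t) :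
    ∫ x, ‖u t x‖ ^ 2 ≤ (2 * kineticEnergy u₀ + kineticEnergy u₀ / (2 * Real.pi ^ 2 * ν)) +
      ((∫ x, ‖g x‖ ^ 2) + (∫ x, ‖g x‖ ^ 2) / (16 * Real.pi ^ 4 * ν ^ 2)) * t := by
  set E : ℝ → ℝ := fun τ => ∫ x, ‖u τ x‖ ^ 2 with hEdef
  set P : ℝ → ℝ := fun τ => ∫ x, ⟪g x, u τ x⟫ with hPdef
  set A2 : ℝ := ∫ x, ‖g x‖ ^ 2 with hA2
  -- energy inequality from `0`, dissipation dropped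
  have hEn : kineticEnergy (u t) + ν * (∫⁻ τ in Ioo 0 t, eGradNormSq (u τ)).toReal ≤
      kineticEnergy u₀ + ∫ τ in (0 : ℝ)..t, P τ :=
    (hu t ht).energy_ineq_zero t ⟨ht.le, le_rfl⟩
  have hdiss : 0 ≤ ν * (∫⁻ τ in Ioo 0 t, eGradNormSq (u τ)).toReal :=
    mul_nonneg hν.le ENNReal.toReal_nonneg
  -- integrability in time
  have hEint : IntervalIntegrable E volume 0 t :=
    (intervalIntegrable_iff_integrableOn_Ioc_of_le ht.le).2 (hu.integrableOn_integral_norm_sq ht)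
  have hPint : IntervalIntegrable P volume 0 t := by
    have h1 : IntegrableOn (fun s => ∫ x, ⟪u s x, g x⟫) (Ioo 0 t) :=
      (hu t ht).integrableOn_integral_inner hg.continuous
    have h2 : P = fun s => ∫ x, ⟪u s x, g x⟫ := by
      funext s
      exact integral_congr_ae (ae_of_all _ fun x => real_inner_comm _ _)
    rw [intervalIntegrable_iff_integrableOn_Ioc_of_le ht.le, h2]
    exact (integrableOn_Ioc_iff_integrableOn_Ioo).mpr h1
  -- the work bound
  have hP : ∀ τ ∈ Icc (0 : ℝ) t, P τ ≤ 2⁻¹ * (A2 + E τ) := fun τ hτ => by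
    have h := integral_inner_le_young one_pos (hg.memLp 2) (hu.memLp_two hτ.1)
    have heq : (∫ x, ‖g x‖ ^ 2) / (2 * 1) + 1 / 2 * ∫ x, ‖u τ x‖ ^ 2 = 2⁻¹ * (A2 + E τ) := by
      simp only [hA2, hEdef]
      ring
    exact h.trans_eq heq
  have hIP : ∫ τ in (0 : ℝ)..t, P τ ≤ ∫ τ in (0 : ℝ)..t, 2⁻¹ * (A2 + E τ) :=
    intervalIntegral.integral_mono_on ht.le hPint
      ((_root_.intervalIntegrable_const.add hEint).const_mul _) hP
  rw [intervalIntegral.integral_const_mul, intervalIntegral.integral_add _root_.intervalIntegrable_const hEint,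
    intervalIntegral.integral_const, sub_zero, smul_eq_mul] at hIP
  -- the tree's linear bound on `∫₀ᵗ ‖u‖²`, at zero momentum
  have hL := hu.intervalIntegral_norm_sq_le hν hg hg0 ht
  have hmom : ∫ x, u 1 x = 0 := hasZeroMean_slice hg hg0 hu₀ h0 hu one_pos
  rw [hmom, norm_zero, zero_pow two_ne_zero, mul_zero, zero_add] at hL
  have hEt : E t = 2 * kineticEnergy (u t) := by
    simp only [hEdef, kineticEnergy]
    ring
  have hK0 : 0 ≤ kineticEnergy u₀ := kineticEnergy_nonneg _
  have hA2_0 : 0 ≤ A2 := integral_nonneg fun _ => sq_nonneg _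
  show E t ≤ _
  rw [hEt]
  nlinarith [hEn, hdiss, hIP, hL]

/-- **ENERGY FLOOR for the witnesses of the crux.** Let `g` be smooth, divergence free and mean
zero, `ν > 0`, `u₀ ∈ L²` with zero mean, and `u` a global Leray–Hopf solution forced by `g`. If
`∑ᵢ ‖∂ᵢ g‖ ≤ D` and `‖Δg‖ ≤ K` pointwise, then
`‖g‖₂² ≤ D ⟨‖u‖²⟩ + (νK/2)(1 + ⟨‖u‖²⟩)`.
Proof: test the weak formulation with `g` itself (`Torus.IsLerayHopfOn.integral_inner_eq_add_setIntegral`):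
`⟨u(T),g⟩ - ⟨u₀,g⟩ = ∫₀ᵀ (⟨u,(u·∇)g⟩ + ν⟨u,Δg⟩ + ‖g‖₂²)`, bound the convective pairing by
`D‖u‖₂²` and the viscous one by `K‖u‖₁ ≤ ½K(1 + ‖u‖₂²)`, divide by `T` (the boundary terms are
`O(√T)` by `integral_norm_sq_le_affine`) and let `T → ∞` along the `limsup`.
CONSEQUENCE FOR THE CRUX (tightness of the sought constant): along any witness family,
`E ≥ ⟨‖v_j‖²⟩ ≥ (‖g‖₂² - ν_jK/2)/(D + ν_jK/2) → ‖g‖₂²/D`: the bound `E` can never be smaller than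
`‖g‖₂²/‖∇g‖_∞`, and the flow cannot decorrelate from the force by becoming small — the balance laws
pin the witness energy between an `O(1)` floor and the sought `O(1)` ceiling, with no `ν⁻¹` growth
(which is why they cannot kill the crux). [folklore] -/
theorem energy_floor (hν : 0 < ν) (hg : IsSmooth g) (hgd : IsDivFree g) (hg0 : HasZeroMean g)
    (hu₀ : MemLp u₀ 2 volume) (h0 : HasZeroMean u₀)
    (hu : Torus.IsGlobalLerayHopf ν (fun _ => g) u₀ u)
    {D : ℝ} (hD : ∀ x, ∑ i, ‖partialDeriv i g x‖ ≤ D) {K : ℝ} (hK0 : 0 ≤ K)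
    (hK : ∀ x, ‖laplacian g x‖ ≤ K) :
    ∫ x, ‖g x‖ ^ 2 ≤ D * meanEnergy u + ν * K / 2 * (1 + meanEnergy u) := by
  set E : ℝ → ℝ := fun τ => ∫ x, ‖u τ x‖ ^ 2 with hEdef
  set A2 : ℝ := ∫ x, ‖g x‖ ^ 2 with hA2
  set Φ : ℝ → ℝ := fun s => ∫ x, ⟪u s x, g x⟫ with hΦ
  set B₀ : ℝ := |∫ x, ⟪u₀ x, g x⟫| with hB₀
  set c : ℝ := D + ν * K / 2 with hc
  have hD0 : 0 ≤ D := (Finset.sum_nonneg fun i _ => norm_nonneg _).trans (hD 0)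
  have hc0 : 0 ≤ c := by positivity
  have hA2_0 : 0 ≤ A2 := integral_nonneg fun _ => sq_nonneg _
  have hE0 : ∀ τ, 0 ≤ E τ := fun τ => integral_nonneg fun _ => sq_nonneg _
  have hB₀0 : 0 ≤ B₀ := abs_nonneg _
  have hfm : ∀ T : ℝ, AEStronglyMeasurable (stLift fun _ : ℝ => g)
      (volume.restrict (Ioo 0 T ×ˢ univ)) := fun T => aestronglyMeasurable_stLift_steady hg.continuous _
  have hf₂ : ∀ T : ℝ, ∫⁻ _ in Ioo (0 : ℝ) T, ∫⁻ x, ‖g x‖ₑ ^ 2 < ⊤ := fun T =>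
    lintegral_Ioo_lintegral_enorm_sq_steady_lt_top (hg.memLp 2) T
  -- STEP 1: the Cesàro inequality `A2·T ≤ |Φ T| + B₀ + (νK/2) T + c ∫₀ᵀ E`
  have step1 : ∀ T, 0 < T → A2 * T ≤ |Φ T| + B₀ + ν * K / 2 * T + c * ∫ s in Ioc 0 T, E s := by
    intro T hT
    set flux : ℝ → ℝ := fun s =>
      ∫ x, (⟪u s x, convect (u s) g x⟫ + ν * ⟪u s x, laplacian g x⟫ + ⟪g x, g x⟫) with hflux
    have hid : Φ T = (∫ x, ⟪u₀ x, g x⟫) + ∫ s in Ioc 0 T, flux s :=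
      (hu T hT).integral_inner_eq_add_setIntegral hT (hfm T) (hf₂ T) hg hgd ⟨hT, le_rfl⟩
    have hlow : ∀ s ∈ Ioc (0 : ℝ) T, (A2 - ν * K / 2) - c * E s ≤ flux s := by
      intro s hs
      have hmem : MemLp (u s) 2 volume := hu.memLp_two hs.1.le
      have i1 := integrable_inner_convect_self hmem hg
      have i2 : Integrable (fun x => ⟪u s x, laplacian g x⟫) volume :=
        integrable_inner_of_continuous (hmem.integrable one_le_two) hg.laplacian.continuous
      have i3 : Integrable (fun x => ⟪g x, g x⟫) volume :=
        integrable_inner_of_continuous hg.integrable hg.continuous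
      have i12 : Integrable (fun x => ⟪u s x, convect (u s) g x⟫ + ν * ⟪u s x, laplacian g x⟫)
          volume := i1.add (i2.const_mul ν)
      have hsplit : flux s = (∫ x, ⟪u s x, convect (u s) g x⟫) +
          ν * (∫ x, ⟪u s x, laplacian g x⟫) + A2 := by
        simp only [hflux]
        rw [integral_add i12 i3, integral_add i1 (i2.const_mul ν), integral_const_mul]
        congr 1
        simp only [hA2]
        exact integral_congr_ae (ae_of_all _ fun x => real_inner_self_eq_norm_sq _)
      have b1 : |∫ x, ⟪u s x, convect (u s) g x⟫| ≤ D * E s :=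
        abs_integral_inner_convect_self_le hmem hg hD
      have b2 : |∫ x, ⟪u s x, laplacian g x⟫| ≤ K * (2⁻¹ * (1 + E s)) :=
        (abs_integral_inner_le_of_norm_le (hmem.integrable one_le_two) hK).trans
          (mul_le_mul_of_nonneg_left (integral_norm_le_of_memLp_two hmem) hK0)
      rw [hsplit]
      have hb1 := neg_abs_le (∫ x, ⟪u s x, convect (u s) g x⟫)
      have hb2 := neg_abs_le (∫ x, ⟪u s x, laplacian g x⟫)
      have hb2' : -(K * (2⁻¹ * (1 + E s))) ≤ ∫ x, ⟪u s x, laplacian g x⟫ := by linarith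
      have hb3 : ν * -(K * (2⁻¹ * (1 + E s))) ≤ ν * ∫ x, ⟪u s x, laplacian g x⟫ :=
        mul_le_mul_of_nonneg_left hb2' hν.le
      simp only [hc]
      linarith
    have hfluxInt : IntegrableOn flux (Ioc 0 T) :=
      (integrableOn_Ioc_iff_integrableOn_Ioo).2 ((hu T hT).integrableOn_flux (hfm T) (hf₂ T) hg)
    have hEInt : IntegrableOn E (Ioc 0 T) := hu.integrableOn_integral_norm_sq hT
    have hconstInt : IntegrableOn (fun _ : ℝ => A2 - ν * K / 2) (Ioc 0 T) :=
      integrableOn_const (hs := measure_Ioc_lt_top.ne)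
    have hlowInt : IntegrableOn (fun s => (A2 - ν * K / 2) - c * E s) (Ioc 0 T) :=
      hconstInt.sub (hEInt.const_mul c)
    have hmono := setIntegral_mono_on hlowInt hfluxInt measurableSet_Ioc hlow
    have hcomp : ∫ s in Ioc 0 T, ((A2 - ν * K / 2) - c * E s) =
        (A2 - ν * K / 2) * T - c * ∫ s in Ioc 0 T, E s := by
      rw [integral_sub hconstInt (hEInt.const_mul c), setIntegral_const, integral_const_mul,
        Real.volume_real_Ioc_of_le hT.le, sub_zero, smul_eq_mul, mul_comm]
    have hΦT := le_abs_self (Φ T)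
    have hΦ0 := neg_abs_le (∫ x, ⟪u₀ x, g x⟫)
    rw [hcomp] at hmono
    simp only [hB₀]
    linarith
  -- STEP 2: the boundary terms are `O(√T)`
  obtain ⟨a, b, ha, hb, hEab⟩ : ∃ a b : ℝ, 0 ≤ a ∧ 0 ≤ b ∧ ∀ t, 0 < t → E t ≤ a + b * t := by
    refine ⟨2 * kineticEnergy u₀ + kineticEnergy u₀ / (2 * Real.pi ^ 2 * ν),
      A2 + A2 / (16 * Real.pi ^ 4 * ν ^ 2), ?_, ?_, fun t ht =>
      integral_norm_sq_le_affine hν hg hg0 hu₀ h0 hu ht⟩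
    · have := kineticEnergy_nonneg u₀
      positivity
    · positivity
  set R : ℝ := Real.sqrt (a + b) * Real.sqrt A2 + B₀ with hR
  have hR0 : 0 ≤ R := by positivity
  have step2 : ∀ T, 1 ≤ T → |Φ T| + B₀ ≤ R * Real.sqrt T := by
    intro T hT
    have hT0 : 0 < T := one_pos.trans_le hT
    have h1 : |Φ T| ≤ Real.sqrt (E T) * Real.sqrt A2 :=
      abs_integral_inner_le_sqrt_mul_sqrt (hu.memLp_two hT0.le) (hg.memLp 2)
    have h2 : E T ≤ (a + b) * T := by
      have := hEab T hT0
      nlinarith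
    have h3 : Real.sqrt (E T) ≤ Real.sqrt (a + b) * Real.sqrt T := by
      rw [← Real.sqrt_mul (by positivity)]
      exact Real.sqrt_le_sqrt h2
    have h4 : 1 ≤ Real.sqrt T := by
      rw [← Real.sqrt_one]
      exact Real.sqrt_le_sqrt hT
    have h5 : B₀ ≤ B₀ * Real.sqrt T := le_mul_of_one_le_right hB₀0 h4
    have hA : 0 ≤ Real.sqrt A2 := Real.sqrt_nonneg _
    calc |Φ T| + B₀ ≤ Real.sqrt (a + b) * Real.sqrt T * Real.sqrt A2 + B₀ * Real.sqrt T := by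
          gcongr
          exact h1.trans (mul_le_mul_of_nonneg_right h3 hA)
      _ = R * Real.sqrt T := by
          simp only [hR]
          ring
  -- STEP 3: pass to the `limsup`
  set M : ℝ := meanEnergy u with hM
  have hM0 : 0 ≤ M := longTimeAvgSup_nonneg fun t => integral_nonneg fun _ => sq_nonneg _
  have hlimsup : limsup (timeMean E) atTop = M := by
    rw [hM, meanEnergy_eq_longTimeAvgSup, longTimeAvgSup]
  have hbdd : IsBoundedUnder (· ≤ ·) atTop (timeMean E) :=
    ⟨_, (eventually_ge_atTop (1 : ℝ)).mono fun T hT => hu.timeMean_norm_sq_le hν hg hg0 hT⟩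
  by_contra hcon
  push Not at hcon
  set δ : ℝ := A2 - (D * M + ν * K / 2 * (1 + M)) with hδ
  have hδ0 : 0 < δ := by
    simp only [hδ]
    linarith
  set ε : ℝ := δ / (2 * (1 + c)) with hε
  have hε0 : 0 < ε := by positivity
  have hεc : ε * (2 * (1 + c)) = δ := div_mul_cancel₀ δ (by positivity)
  have hev1 : ∀ᶠ T in atTop, timeMean E T < M + ε :=
    eventually_lt_of_limsup_lt (by rw [hlimsup]; linarith) hbdd
  have hev2 : ∀ᶠ T in atTop, max 1 ((R / ε) ^ 2) ≤ T := eventually_ge_atTop _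
  obtain ⟨T, hT1, hT2⟩ := (hev1.and hev2).exists
  have hT1' : 1 ≤ T := (le_max_left _ _).trans hT2
  have hT0 : 0 < T := one_pos.trans_le hT1'
  -- boundary ≤ ε T
  have hsqrtT : R / ε ≤ Real.sqrt T := by
    have h := Real.sqrt_le_sqrt ((le_max_right _ _).trans hT2)
    rwa [Real.sqrt_sq (by positivity)] at h
  have hbdry : |Φ T| + B₀ ≤ ε * T := by
    refine (step2 T hT1').trans ?_
    have h1 : R ≤ ε * Real.sqrt T := by
      rw [div_le_iff₀ hε0] at hsqrtT
      linarith
    have h2 : R * Real.sqrt T ≤ ε * Real.sqrt T * Real.sqrt T :=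
      mul_le_mul_of_nonneg_right h1 (Real.sqrt_nonneg _)
    rwa [mul_assoc, Real.mul_self_sqrt hT0.le] at h2
  -- the mean: `∫₀ᵀ E = T · timeMean E T`
  have hmean : ∫ s in Ioc 0 T, E s = T * timeMean E T := by
    rw [timeMean, intervalIntegral.integral_of_le hT0.le, ← mul_assoc, mul_inv_cancel₀ hT0.ne', one_mul]
  have hI : c * ∫ s in Ioc 0 T, E s ≤ c * (T * (M + ε)) := by
    rw [hmean]
    exact mul_le_mul_of_nonneg_left (mul_le_mul_of_nonneg_left hT1.le hT0.le) hc0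
  have key := step1 T hT0
  have key2 : A2 * T ≤ (ε + ν * K / 2 + c * (M + ε)) * T := by nlinarith
  have key3 : A2 ≤ ε + ν * K / 2 + c * (M + ε) := le_of_mul_le_mul_right key2 hT0
  have : δ ≤ ε * (1 + c) := by
    simp only [hδ, hc] at key3 ⊢
    nlinarith
  nlinarith

/-- **The ceiling is at least the floor.** In the notation of the crux: if `g` (smooth,
divergence free, mean zero, `∑ᵢ‖∂ᵢ g‖ ≤ D`, `‖Δg‖ ≤ K` pointwise) admits zero-momentum global
Leray–Hopf families along `ν_j → 0⁺` with `⟨‖v_j‖²⟩ ≤ E` for all `j`, then `‖g‖₂² ≤ D·E`.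
So the constant of any witness of the crux obeys `E ≥ ‖g‖₂²/‖∇g‖_∞`: bounded-energy witnesses
live at energies comparable to the sweeping scale `‖g‖₂/‖∇g‖_∞` or above, never below (and in
particular the witness flow cannot decorrelate from `g` by being small). [folklore] -/
theorem witness_ceiling_ge_floor (hg : IsSmooth g) (hgd : IsDivFree g) (hg0 : HasZeroMean g)
    {D : ℝ} (hD : ∀ x, ∑ i, ‖partialDeriv i g x‖ ≤ D) {K : ℝ} (hK0 : 0 ≤ K)
    (hK : ∀ x, ‖laplacian g x‖ ≤ K) {νs : ℕ → ℝ} {v₀ : ℕ → 𝕋² → E²}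
    {v : ℕ → ℝ → 𝕋² → E²} (hν : ∀ j, 0 < νs j) (hν0 : Tendsto νs atTop (𝓝 0))
    (hdata : ∀ j, MemLp (v₀ j) 2 volume ∧ HasZeroMean (v₀ j))
    (hLH : ∀ j, Torus.IsGlobalLerayHopf (νs j) (fun _ => g) (v₀ j) (v j)) {E : ℝ}
    (hE : ∀ j, meanEnergy (v j) ≤ E) :
    ∫ x, ‖g x‖ ^ 2 ≤ D * E := by
  have hD0 : 0 ≤ D := (Finset.sum_nonneg fun i _ => norm_nonneg _).trans (hD 0)
  have hM0 : ∀ j, 0 ≤ meanEnergy (v j) := fun j =>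
    longTimeAvgSup_nonneg fun t => integral_nonneg fun _ => sq_nonneg _
  have hE0 : 0 ≤ E := (hM0 0).trans (hE 0)
  have hj : ∀ j, ∫ x, ‖g x‖ ^ 2 ≤ D * E + νs j * (K / 2 * (1 + E)) := fun j => by
    have h := energy_floor (hν j) hg hgd hg0 (hdata j).1 (hdata j).2 (hLH j) hD hK0 hK
    have h1 : D * meanEnergy (v j) ≤ D * E := mul_le_mul_of_nonneg_left (hE j) hD0
    have h2 : νs j * K / 2 * (1 + meanEnergy (v j)) ≤ νs j * (K / 2 * (1 + E)) := by
      have h3 : K / 2 * (1 + meanEnergy (v j)) ≤ K / 2 * (1 + E) :=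
        mul_le_mul_of_nonneg_left (by linarith [hE j]) (by positivity)
      have h4 := mul_le_mul_of_nonneg_left h3 (hν j).le
      linarith [h4]
    linarith
  have hlim : Tendsto (fun j => D * E + νs j * (K / 2 * (1 + E))) atTop (𝓝 (D * E)) := by
    have := (hν0.mul_const (K / 2 * (1 + E))).const_add (D * E)
    simpa using this
  exact ge_of_tendsto' hlim hj

end Floor

/-! ## §F (gen 2) The whole first Stokes eigenspace is rigid; every witness force has a mode with `|k|² ≥ 2`

Thin index of the landed file `Negative/FirstShellGeneral.lean` (with `FirstShellGalerkin`,
`FirstShellTrilinear`), namespace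
`Summit.AnomalousDissipation.AnomalousDissipation.Theorems.TwodBoundedEnergyZeroMomentum.Negative`
— import that module to use them. -/

section FirstShellGeneral

open Summit.AnomalousDissipation.AnomalousDissipation.Theorems.TwodBoundedEnergyZeroMomentum

variable {ν : ℝ} {g u₀ : 𝕋² → E²} {u : ℝ → 𝕋² → E²}

/-- **Laminar energy floor under ANY first-shell force** (FMRT 2001 Ch. III §3.1: the first
eigenvalue has multiplicity 4): for `g` smooth, divergence free, mean zero, with `ĝ(k) = 0`
whenever `|k|² ≠ 1`, every zero-momentum global Leray–Hopf solution has
`⟨‖u‖²⟩ ≥ ‖g‖₂²/(16π⁴ν²)`. TIGHTNESS LEMMA (whole first eigenspace). [cite: FoiasManleyRosaTemam2001, Ch. III (3.35) and App. III.A.4] -/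
theorem meanEnergy_ge_of_firstShell (hν : 0 < ν) (hg : IsSmooth g) (hgd : IsDivFree g)
    (hgm : HasZeroMean g)
    (hg1 : ∀ k : ℤ², freqNormSq k ≠ 1 → mFourierCoeff (EuclideanSpace.complexify ∘ g) k = 0)
    (hu₀ : MemLp u₀ 2 volume) (h0 : HasZeroMean u₀)
    (hu : Torus.IsGlobalLerayHopf ν (fun _ => g) u₀ u) :
    (∫ x, ‖g x‖ ^ 2) / (16 * Real.pi ^ 4 * ν ^ 2) ≤ meanEnergy u :=
  Negative.meanEnergy_ge_of_firstShell hν hg hgd hgm hg1 hu₀ h0 hu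

/-- **The crux restricted to first-shell forces is FALSE — whole first eigenspace** (the crux
with the ONE extra conjunct `∀ k, |k|² ≠ 1 → ĝ(k) = 0`). Supersedes `not_crux_firstMode`. [cite: FoiasManleyRosaTemam2001, Ch. III (3.35) and App. III.A.4] -/
theorem not_crux_firstShell :
    ¬ ∃ g : 𝕋² → E², IsSmooth g ∧ IsDivFree g ∧ HasZeroMean g ∧ g ≠ 0 ∧
      (∀ k : ℤ², freqNormSq k ≠ 1 → mFourierCoeff (EuclideanSpace.complexify ∘ g) k = 0) ∧
      ∃ (ν : ℕ → ℝ) (v₀ : ℕ → 𝕋² → E²) (v : ℕ → ℝ → 𝕋² → E²),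
        (∀ j, 0 < ν j) ∧ Tendsto ν atTop (𝓝 0) ∧
        (∀ j, MemLp (v₀ j) 2 volume ∧ HasZeroMean (v₀ j)) ∧
        (∀ j, Torus.IsGlobalLerayHopf (ν j) (fun _ => g) (v₀ j) (v j)) ∧
        ∃ E : ℝ, ∀ j, meanEnergy (v j) ≤ E :=
  Negative.not_TwodBoundedEnergyZeroMomentum_firstShell

/-- **DESIGN CONSTRAINT: every witness force of the crux has a Fourier mode with `|k|² ≥ 2`.** [folklore] -/
theorem witness_has_mode_two_le (hg : IsSmooth g) (hgd : IsDivFree g) (hgm : HasZeroMean g)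
    (hg0 : g ≠ 0) {νs : ℕ → ℝ} {v₀ : ℕ → 𝕋² → E²} {v : ℕ → ℝ → 𝕋² → E²}
    (hν : ∀ j, 0 < νs j) (hν0 : Tendsto νs atTop (𝓝 0))
    (hdata : ∀ j, MemLp (v₀ j) 2 volume ∧ HasZeroMean (v₀ j))
    (hLH : ∀ j, Torus.IsGlobalLerayHopf (νs j) (fun _ => g) (v₀ j) (v j)) {E : ℝ}
    (hE : ∀ j, meanEnergy (v j) ≤ E) :
    ∃ k : ℤ², 2 ≤ freqNormSq k ∧ mFourierCoeff (EuclideanSpace.complexify ∘ g) k ≠ 0 :=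
  Negative.exists_mode_two_le_of_witness hg hgd hgm hg0 hν hν0 hdata hLH hE

/-- **Steady states under a first-shell force sit at or above the laminar energy**: for a smooth
zero-mean steady state `v` of `NS_ν(g)` (`Torus.IsSteadyNSState`), `∫ ‖v‖² ≥ ‖g‖₂²/(16π⁴ν²)`. [folklore] -/
theorem steady_energy_ge_of_firstShell (hν : 0 < ν) (hg : IsSmooth g) (hgd : IsDivFree g)
    (hgm : HasZeroMean g)
    (hg1 : ∀ k : ℤ², freqNormSq k ≠ 1 → mFourierCoeff (EuclideanSpace.complexify ∘ g) k = 0)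
    {v : 𝕋² → E²} {p : 𝕋² → ℝ} (hv : Torus.IsSteadyNSState ν g v p) (hvm : HasZeroMean v) :
    (∫ x, ‖g x‖ ^ 2) / (16 * Real.pi ^ 4 * ν ^ 2) ≤ ∫ x, ‖v x‖ ^ 2 :=
  Negative.integral_norm_sq_ge_of_steady_firstShell hν hg hgd hgm hg1 hv hvm

/-- **No bounded steady branch under a first-shell force** (the steady sub-case every round-1
crux idea aims at, plus the first-shell clause) — refuted special case of the cards' transfer
target `BoundedSteadyBranch`. [folklore] -/
theorem not_boundedSteadyBranch_firstShell :
    ¬ ∃ g : 𝕋² → E², IsSmooth g ∧ IsDivFree g ∧ HasZeroMean g ∧ g ≠ 0 ∧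
      (∀ k : ℤ², freqNormSq k ≠ 1 → mFourierCoeff (EuclideanSpace.complexify ∘ g) k = 0) ∧
      ∃ (ν : ℕ → ℝ) (v : ℕ → 𝕋² → E²) (p : ℕ → 𝕋² → ℝ),
        (∀ j, 0 < ν j) ∧ Tendsto ν atTop (𝓝 0) ∧
        (∀ j, Torus.IsSteadyNSState (ν j) g (v j) (p j)) ∧ (∀ j, HasZeroMean (v j)) ∧
        ∃ E : ℝ, ∀ j, ∫ x, ‖v j x‖ ^ 2 ≤ E :=
  Negative.not_boundedSteadyBranch_firstShell

end FirstShellGeneral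

/-! ## §G (gen 2) Steady witnesses: exact balance laws and the single-shell straddle identity

Thin index of the landed file `Negative/SteadyShellIdentity.lean` (p76689). -/

section SteadyToolbox

open Summit.AnomalousDissipation.AnomalousDissipation.Theorems.TwodBoundedEnergyZeroMomentum

variable {ν : ℝ} {g v : 𝕋² → E²} {p : 𝕋² → ℝ}

/-- **Work = dissipation for steady witnesses**: `ν‖∇v‖₂² = ∫⟪g, v⟫` (CTV 2013 §2). [cite: ConstantinTarfuleaVicol2013, §2] -/
theorem steady_energy_identity (hv : Torus.IsSteadyNSState ν g v p) :
    ν * gradNormSq v = ∫ x, ⟪g x, v x⟫_ℝ :=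
  Negative.steady_energy_identity hv

/-- **Enstrophy identity for steady witnesses on `𝕋²`**: `ν∫‖Δv‖² = -∫⟪v, Δg⟫` (CTV 2013 §2). [cite: ConstantinTarfuleaVicol2013, §2] -/
theorem steady_enstrophy_identity (hv : Torus.IsSteadyNSState ν g v p) :
    ν * ∫ x, ‖laplacian v x‖ ^ 2 = -∫ x, ⟪v x, laplacian g x⟫_ℝ :=
  Negative.steady_enstrophy_identity hv

/-- **CTV's single-shell identity**: `Δg = -Λg`, `ν ≠ 0` ⇒ `∫‖Δv‖² = Λ‖∇v‖₂²` for every smooth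
steady state; spectrally `∑_k λ_k(λ_k - Λ)‖v̂(k)‖² = 0`. [cite: ConstantinTarfuleaVicol2013, §2 (h2bal)] -/
theorem steady_laplacian_sq_eq_of_stokesEigenforce (hν : ν ≠ 0) (hv : Torus.IsSteadyNSState ν g v p)
    {Λ : ℝ} (hΛ : ∀ x, laplacian g x = -Λ • g x) :
    ∫ x, ‖laplacian v x‖ ^ 2 = Λ * gradNormSq v :=
  Negative.steady_laplacian_sq_eq_of_stokesEigenforce hν hv hΛ

/-- **STRADDLE CONSTRAINT** for steady witnesses under Kolmogorov (single-shell) forcing: no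
Fourier mode strictly above the forcing shell ⇒ none strictly below it (bar the mean). A steady
witness carrying a condensate therefore carries super-shell modes. [cite: ConstantinTarfuleaVicol2013, §2 (h2bal)] -/
theorem steady_no_subshell_mode_of_no_supershell_mode (hν : ν ≠ 0)
    (hv : Torus.IsSteadyNSState ν g v p) {Λ : ℝ} (hΛ : ∀ x, laplacian g x = -Λ • g x)
    (habove : ∀ k : ℤ², Λ < 4 * Real.pi ^ 2 * freqNormSq k →
      mFourierCoeff (EuclideanSpace.complexify ∘ v) k = 0)
    {k : ℤ²} (hk0 : 0 < freqNormSq k) (hk : 4 * Real.pi ^ 2 * freqNormSq k < Λ) :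
    mFourierCoeff (EuclideanSpace.complexify ∘ v) k = 0 :=
  Negative.steady_no_subshell_mode_of_no_supershell_mode hν hv hΛ habove hk0 hk

/- REFUTER'S QUANTITATIVE REMARK on the straddle identity (paper; aimed at the card
   parity-protected-swept-condensate, rev 2; not a theorem).  Write the steady witness as
   `v = UΦ-flow + w` (condensate on the first shell, 2π-normalisation `λ₁ = 1`, energy `U²`;
   single-shell force at `λ_f = k_f²`).  The EXACT identity `‖Δv‖² = λ_f‖∇v‖²`
   (`steady_laplacian_sq_eq_of_stokesEigenforce`) reads
       `Σ_k λ_k(λ_k - λ_f)|ŵ_k|²  =  (λ_f - 1) U²  ≈  k_f² U²`,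
   i.e. the eddy must carry a PALINSTROPHY EXCESS of order `k_f²U²` above the forcing shell.  A swept
   linear response lives at `|k| ≈ k_f ± M` with `M = O(1)` shifts, where `λ_k - λ_f ≤ 2k_fM + M²`,
   so its excess is at most `≈ 2k_fM · λ_f‖w‖₂² ≈ 2k_f³M‖w‖₂²`; with the card's own size
   `‖w‖₂² ~ 1/(k_f²U²)` (`w¹ ~ 1/(k_fU)`) this is `≲ 2k_fM/U²`.  Hence `U⁴ ≲ 2M/k_f`: at `M = O(1)`
   the condensate amplitude must DECREASE like `k_f^{-1/4}`, whereas the card's selection law is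
   `U* ~ k_f^{+1/5}`.  Equivalently the card's amplitude needs eddy content out to shifts
   `M ≳ U⁴k_f/2 ~ k_f^{9/5}/2` — a spread to wavenumbers `≫ 2k_f`, i.e. NOT a swept series with
   bounded palinstrophy.  At the card's `(k,l) = (4,2)` (`k_f ≈ 4.5`, `U* ≈ 1.35`) this means
   significant eddy palinstrophy out to `|k| ≈ 12`; an O(1) tension today, a scaling contradiction as
   `k_f → ∞`.  CHEAP CHECK for the line: evaluate `Σ λ(λ - λ_f)|ŵ|²` on the computed cell response of
   kit job j008599 and compare with `(λ_f - 1)U*²`.  (For multi-shell designs — internal-galilean-jets,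
   detuned-shear, bilinear-orbit, forced-euler-anchor — the identity is replaced by
   `ν∫‖Δv‖² = -∫⟪v,Δg⟫`, `steady_enstrophy_identity`, which does not pin the spectrum.) -/

end SteadyToolbox

/-! ## §H–§H' (gen 2) Cone, bounds and the strain floor — thin index of `Negative/SteadyScaling.lean`
(p77269), `Negative/SteadyBounds.lean` (p77406), `Negative/EnergyFloorSym.lean` (p77468) -/

section ConeBoundsFloor

open Summit.AnomalousDissipation.AnomalousDissipation.Theorems.TwodBoundedEnergyZeroMomentum

variable {ν : ℝ} {g v u₀ : 𝕋² → E²} {p : 𝕋² → ℝ} {u : ℝ → 𝕋² → E²}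

/-- **Steady witnesses scale**: `(ν,g,v,p) ↦ (aν, a²g, av, a²p)` preserves `IsSteadyNSState` — the
bounded-steady-branch forces form a cone (only the SHAPE of `g` matters). [folklore] -/
theorem steady_smul (hv : Torus.IsSteadyNSState ν g v p) (a : ℝ) :
    Torus.IsSteadyNSState (a * ν) (fun x => a ^ 2 • g x) (fun x => a • v x) (fun x => a ^ 2 • p x) :=
  Negative.steady_smul hv a

/-- **Steady Alexakis–Doering bound**: `(∫⟪g,v⟫)² ≤ ν‖v‖₂²(‖v‖₂‖Δg‖₂)` — injection = dissipation is
`O(ν^{1/2})` on bounded steady branches; every `L²` limit of a branch does no work. [cite: ConstantinTarfuleaVicol2013, §2] -/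
theorem steady_work_sq_le (hν : 0 ≤ ν) (hv : Torus.IsSteadyNSState ν g v p) :
    (∫ x, ⟪g x, v x⟫_ℝ) ^ 2 ≤
      ν * (∫ x, ‖v x‖ ^ 2) * (Real.sqrt (∫ x, ‖v x‖ ^ 2) * Real.sqrt (∫ x, ‖laplacian g x‖ ^ 2)) :=
  Negative.steady_work_sq_le hν hv

/-- **Uniform `H²` bounds for steady states under a Stokes eigenforce** (`Δg = -Λg`, `Λ ≥ 0`,
`ν ≠ 0`): `‖∇v‖₂² ≤ Λ‖v‖₂²`, `∫‖Δv‖² ≤ Λ²‖v‖₂²` (CTV 2013 §2 (stbounds)): no vanishing-width layers on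
bounded steady branches under Kolmogorov forcing. [cite: ConstantinTarfuleaVicol2013, §2 (stbounds)] -/
theorem steady_sobolev_bounds_of_stokesEigenforce (hν : ν ≠ 0) (hv : Torus.IsSteadyNSState ν g v p)
    {Λ : ℝ} (hΛ : ∀ x, laplacian g x = -Λ • g x) (hΛ0 : 0 ≤ Λ) :
    gradNormSq v ≤ Λ * ∫ x, ‖v x‖ ^ 2 ∧ ∫ x, ‖laplacian v x‖ ^ 2 ≤ Λ ^ 2 * ∫ x, ‖v x‖ ^ 2 :=
  Negative.steady_sobolev_bounds_of_stokesEigenforce hν hv hΛ hΛ0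

/-- **A condensate costs palinstrophy above the forcing shell** (single-shell force `Δg = -Λg`,
`Λ ≥ 4π²`): `4π²(Λ - 4π²)·∑_{|k|²=1}‖v̂‖² ≤ ∑_{λ_k>Λ} λ_k²‖v̂‖²` for every steady state. [cite: ConstantinTarfuleaVicol2013, §2 (h2bal)] -/
theorem steady_firstShell_energy_le_supershell_palinstrophy (hν : ν ≠ 0)
    (hv : Torus.IsSteadyNSState ν g v p) {Λ : ℝ} (hΛ : ∀ x, laplacian g x = -Λ • g x)
    (hΛ1 : 4 * Real.pi ^ 2 ≤ Λ) :
    4 * Real.pi ^ 2 * (Λ - 4 * Real.pi ^ 2) *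
        ∑ k ∈ shellOne, ‖mFourierCoeff (EuclideanSpace.complexify ∘ v) k‖ ^ 2 ≤
      ∑' k : ℤ², (if Λ < 4 * Real.pi ^ 2 * freqNormSq k then
        (4 * Real.pi ^ 2 * freqNormSq k) ^ 2 * ‖mFourierCoeff (EuclideanSpace.complexify ∘ v) k‖ ^ 2
        else 0) :=
  Negative.steady_firstShell_energy_le_supershell_palinstrophy hν hv hΛ hΛ1

/-- **Energy floor with the strain constant** (`-M‖w‖² ≤ ⟪w, ∇g(x)w⟫`, i.e. `M = ‖sym∇g‖_∞`):
`‖g‖₂² ≤ M⟨‖u‖²⟩ + (νK/2)(1 + ⟨‖u‖²⟩)` for every zero-momentum global Leray–Hopf solution; along a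
witness family `E ≥ ‖g‖₂²/M`. (Target BN1 of `NegativeNotesIdeator1g2.md`.) [folklore] -/
theorem energy_floor_sym (hν : 0 < ν) (hg : IsSmooth g) (hgd : IsDivFree g) (hg0 : HasZeroMean g)
    (hu₀ : MemLp u₀ 2 volume) (h0 : HasZeroMean u₀)
    (hu : Torus.IsGlobalLerayHopf ν (fun _ => g) u₀ u) {M : ℝ} (hM0 : 0 ≤ M)
    (hM : ∀ (x : 𝕋²) (w : E²), -(M * ‖w‖ ^ 2) ≤ ⟪w, Torus.fderiv g x w⟫_ℝ)
    {K : ℝ} (hK0 : 0 ≤ K) (hK : ∀ x, ‖laplacian g x‖ ≤ K) :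
    ∫ x, ‖g x‖ ^ 2 ≤ M * meanEnergy u + ν * K / 2 * (1 + meanEnergy u) :=
  Negative.energy_floor_sym hν hg hgd hg0 hu₀ h0 hu hM0 hM hK0 hK

end ConeBoundsFloor

end Summit.AnomalousDissipation.AnomalousDissipation.Cruxes.TwodBoundedEnergyZeroMomentum.Disproof

end
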